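/-
Copyright: cell `langlands-arthur-audit` (papers/Langlands/langlands-arthur-audit), unit `pub-arthur-down-g20`
(downstream tracer, gen 20).  Sixth file of the downstream register: `Downstream.lean` (tranches 1–4),
`Downstream2.lean` (5–11), `Downstream3.lean` (12–20), `Downstream4.lean` (21–25) and `Downstream5.lean` (v1 p195450 … v3
p196854, tranches 26–28; 134 082 bytes = 67 % of the gate's 200 000-byte file cap, and a twenty-ninth tranche of the size
below would have taken it to 97 %) are full or nearly so, so the register continues here, APPEND-ONLY in the same
conventions and the same namespace `…Arthur2013.Downstream`; v1 = the twenty-ninth tranche (`Consumers29`: the GSp(4)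
arithmetic line of the cell's block `[g4]` — C87 Loeffler – Pilloni – Skinner – Zerbes 2021, C88 Loeffler – Zerbes 2020,
C89 Loeffler – Rivero 2024, C91 Loeffler – Zerbes 2026 ⇐ book ∧ A4; C86 Loeffler – Zerbes (BSD-type theorem for modular
abelian surfaces) ⇐ book ∧ A4 ∧ C87 ∧ an explicit hypothesis node (the Lan–Skinner vanishing statements the authors
name); C82 A. Weiss 2022 ⇐ book ∧ A4 ∧ C191; C83 T. Yamauchi ⇐ book ∧ A4 ∧ A3 ∧ C191 ∧ C82; C84 Tsuzuki – Yamauchi 2026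
⇐ book ∧ A4 ∧ C191; C85 Berger – Betina 2022 ⇐ book ∧ A4 ∧ C180 ∧ C191; `Implications29`; bookkeeping theorems).
v2 (same unit, APPEND-ONLY): the thirtieth tranche (`Consumers30`: the GSp(4) arithmetic line continued, blocks
`[g5]`/`[g5b]` — C111 / C114 / C120 Shih-Yu Chen (Deligne-type algebraicity for symmetric sixth / fifth / fourth power
L-functions) ⇐ book ∧ A4 (∧ Mok for C111, C120); C127 Lemma – Ochiai 2023 ⇐ book ∧ A4; C119 Le – Le Hung – Lee 2025 ⇐
book ∧ A4 ∧ C9; C112 Wang – Wei – Yan – Yi 2026 ⇐ book ∧ C180 ∧ C182; `Implications30`; bookkeeping theorems); every v1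
declaration unchanged.  v3 (same unit, APPEND-ONLY): the thirty-first tranche (`Consumers31`: the explicit reciprocity law
of the GSp(4) line — NEW census rows C192 Loeffler – Zerbes, Cambridge J. Math. 14 (2026) ⇐ book ∧ A4 ∧ C87 and C193
Loeffler – Zerbes (quadratic Hilbert modular forms, PREPRINT 2025) ⇐ C87 ∧ C192; `Implications31`; bookkeeping theorems,
among them the contrast with row C86's hypothesis node); every v1–v2 declaration unchanged.  v4 (same unit,
APPEND-ONLY): the thirty-second tranche (`Consumers32`: the Chenevier – Lannes / Chenevier – Renard / Chenevier – Taïbi /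
Taïbi line of blocks `[g4]`/`[g5]` — C93 Bergström – Faber 2023 (with their Galois hypothesis as the node `BFgal`) ⇐ C5 ∧
C4 ∧ node; C94 Shmakov 2023 ⇐ C6 ∧ C4; C97 Mégarbané JTNB 2018 ⇐ book ∧ C3 ∧ A3 ∧ B1; C113 Mégarbané JNT 2018 ⇐ C5 ∧ C3 ∧
A3 ∧ B1; and the GU(2,1) row C109 Manji 2025 ⇐ Mok ∧ C110; `Implications32`; bookkeeping theorems); every v1–v3
declaration unchanged.  Nothing of the first five files is redeclared or changed.
-/
import HarnessLib
import Literature.NumberTheory.Automorphic.Arthur2013.Downstream5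

/-!
# Downstream of Arthur (2013), Mok (2015), KMSW (2014): the typed register, sixth file (tranches ≥ 29)

**What is reproduced.**  As in the first five files: for published theorems (here: seven journal articles and two
arXiv preprints) that invoke J. Arthur, *The Endoscopic Classification of Representations* (AMS Colloq. Publ. 61,
2013) [cite: Arthur2013] as a black box — directly or, as throughout this file, through already-typed CONDUIT rows
(A4 Gee–Taïbi [cite: GeeTaibi2019], A3 Taïbi, C180 Schmidt, C191 C.-P. Mok 2014 [cite: Mok2014Compositio]) —, one
HYPOTHESIS `E_…` per statement quoting the sentences in which the paper invokes the classification, recording WHICH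
outputs of the book's dependency DAG and which typed rows the proof consumes; and bookkeeping theorems `…_of_leaves`
composing these hypotheses with the packaged inputs `BookInputs` of `Downstream.lean`, so that the kernel displays the
2026 leaves each downstream theorem rests on.  Quotations are exact substrings of the texts staged with sha256 under
`HOME/pub-arthur-down-g20/primaries/`: the cell's corpus text `paper:arxiv-<id>` (chunk `pNNNN:Ln`) and, for the five
Loeffler et al. papers whose corpus rendering drops the authors' TeX macros, the arXiv e-print SOURCE fetched by a
read-only GET (`arxiv-<id>-src/*.tex`, locator = source line `l.N`).  The book itself was NOT held by the auditing
cell: every « [Arthur2013] », « [arthur04] » inside a quotation is the downstream authors' citation.  Selection of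
consumers and the authors' conditionality wording: the cell's `DOWNSTREAM.md` block `[g4]` (second-order census, unit
pub-arthur-down-g4) and `DOWNSTREAM2.md` block `[g20]` (this tranche).

**Why a twenty-ninth tranche (v1): the GSp(4) arithmetic line through Gee–Taïbi and Mok 2014.**  Item (2) of the
down-g19 successor list (« the remaining 2nd-order rows of blocks [g4]/[g5] »): nine rows of the second-order census,
graded there G-i / G-v and never typed, whose theorems — p-adic L-functions, Euler-system reciprocity laws and
Bloch–Kato-type / BSD-type bounds for GSp₄, algebraicity of L-values, images of and Serre weights for GSp₄-valued
Galois representations, the geometry of the Siegel eigenvariety at Saito–Kurokawa points — consume Arthur's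
classification of the discrete spectrum of GSp₄ « announced in [arthur04] and proved in [geetaibi18] » (the register's
resolution, as for rows C90, C180, C191: the book for PGSp₄ ≅ SO₅ and Gee–Taïbi = row A4 beyond), four of them also
Mok's Compositio theorem (the conduit C191 of tranche 28), one Schmidt's packet structure (C180), one Taïbi's
inner-form multiplicity formula (A3).  One new HYPOTHESIS node rides with C86: the authors' own sentence that the
explicit reciprocity law « relies on the vanishing statements … whose proofs will appear in forthcoming work of
Lan–Skinner » (outside the three DAGs, no supplier edge), next to their status sentence on the classification (« uses
certain cases of the fundamental lemma whose proofs have not yet appeared »).  Status wording found: C82 §0.2 and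
C85's footnote name the twisted weighted fundamental lemma and « unpublished work of Arthur »; C83, C84 defer to « the
second paragraph in p.472 of [GeeT] » (C84 adds an explicitly unconditional generic variant); C86 as quoted; C87, C89,
C91 none (« announced in … and proved in … »); C88 asserts the dependence resolved (« This hypothesis can now be
removed »).  Publication status 2026-08 (Crossref / zbMATH): C87 Duke Math. J. 170 (2021); C88 Adv. Stud. Pure Math.
86 (2020); C89 Q. J. Math. 75 (2024); C91 Forum Math. (2026); C82 J. Lond. Math. Soc. 106 (2022); C84 J. Théor.
Nombres Bordeaux 38 (2026); C85 Ann. Inst. Fourier 72 (2022); C83 and C86 PREPRINTS (zbMATH « Preprint »).  The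
published versions were NOT compared with the arXiv texts read.

**v2: the thirtieth tranche (the GSp(4) arithmetic line continued: Gee–Taïbi users without the disclosure, the BCGP
and Schmidt conduits).**  Six more rows of the second-order census (`DOWNSTREAM.md` blocks `[g5]`, `[g5b]`, unit
pub-arthur-down-g5; graded G-i there, never typed).  C111, C114, C120 (Shih-Yu Chen: Deligne-type algebraicity of the
critical values of symmetric sixth, fifth and fourth power L-functions of (Hilbert) modular newforms, and period relations)
obtain the descent / transfer of Sym³ to GSp₄ and the switch to the holomorphic member of an L-packet from « Arthur's
multiplicity formula for GSp₄(𝔸_𝔽) established by Gee and Taïbi [GT19, Theorem 7.4.1] » (C111 also descends Sym⁶ ⊗ ω⁻³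
to Sp₆ by « [Art13, Theorem 1.5.2] » — the book directly — and to U(2,2) by « Arthur's multiplicity formula [Mok15] »; C120
uses [Mok2015] for the poles of Asai L-functions); C127 (Lemma – Ochiai, Kyoto J. Math. 2023: endoscopic congruences for
GSp(4)) proves the stability of the congruent form Π′ from « the classification of the discrete spectrum of GSp(4) …
proved in [gee-taibi] »; C119 (Le – Le Hung – Lee 2025: the weight part of Serre-type conj.s for GSp₄) takes « Arthur's
multiplicity formula [BCGP] » (row C9, itself ⇐ A4) in the Breuil–Mézard multiplicity count; C112 (Wang – Wei – Yan – Yi,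
Mathematika 2026: refined strong multiplicity one for paramodular newforms) reaches the classification only through
Schmidt's TAMS 2018 and Acta Arith. 2020 papers (rows C180, C182) and [Art04].  No text of the six carries a sentence on the
status of the classification.  Texts: corpus TeX / PDF text (`paper:arxiv-<id>`); for C111 (corpus = PDF text) and C112
(PDF text) also the arXiv e-print sources, staged as in v1.  Publication status 2026-08 (Crossref / zbMATH): C114 Forum
Math. 34 (2022); C120 Adv. Math. 414 (2023); C127 Kyoto J. Math. 63 (2023); C112 Mathematika 72 (2026); C111 and C119
PREPRINTS.  The published versions were NOT compared with the arXiv texts read.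

**v3: the thirty-first tranche (the explicit reciprocity law; the fate of row C86's named external input).**  Two rows
the censuses missed.  C192: D. Loeffler – S. L. Zerbes, *On the Bloch–Kato conj. for GSp(4)*, Cambridge J. Math. 14 (2026)
no. 3, 603–784 (arXiv:2003.05960v4, the accepted version): Theorems A–D (the Bloch–Kato logarithm of the Lemma–Flach /
LSZ Euler system class as a non-critical value of the spin p-adic L-function of [LPSZ1] = row C87; an Euler system with the
p-adic L-function as regulator; one divisibility of the cyclotomic Iwasawa main conj. for V_Π^*; the Bloch–Kato statement
at non-vanishing critical twists), for Π non-endoscopic, non-CAP, globally generic, « of general type in Arthur's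
classification (cf. [arthur04]) » — « (For more details see [arthur04] and [geetaibi18].) » — edge ⇐ book ∧ A4 ∧ C87.  Its
earlier versions (the cell's corpus text `paper:arxiv-2003.05960`) made Theorem A depend on vanishing statements for Hecke
eigenspaces in the rigid cohomology of the Klingen-level Siegel threefold « which will be proven in forthcoming work of Lan
and Skinner » — the statements row C86 (tranche 29) names as its own external input, typed there as the hypothesis node
`Consumers29.LSvanishing`; the version of record REMOVES that dependence (« This is no longer the case », an argument of
Boxer – Pilloni and a weaker unconditional result on the cuspidal boundary).  No Lan – Skinner text exists (arXiv author
query, 2026-08-19).  C193: D. Loeffler – S. L. Zerbes, *Iwasawa theory for quadratic Hilbert modular forms*,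
arXiv:2006.14491v2 (2025; PREPRINT): Theorems A, B (the Kato divisibility and, with Wan's converse, the cyclotomic main
conj. for π on GL₂ over a real quadratic field, p split, π ordinary) « as an application of the results of [LZ20] » with
the coherent realisation, rationality and p-adic L-function of [LPSZ1] — edge ⇐ C87 ∧ C192, no direct book premise: the
v2 source carries its sentence on Arthur's classification only as a TeX comment; its Remark « we have recently revised the
preprint [LZ20] to remove this dependence on forthcoming work; so the results of that paper, and hence of this one, are
now unconditional » is the only printed status sentence of the pair and concerns the eigenspace statements, not the
classification.  Row C86 is NOT re-typed: its latest text (v3, July 2023) still prints the dependence, and no text read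
says whether its generalised reciprocity law inherits the new argument; the bookkeeping theorem
`reciprocityLine_and_C86` displays the contrast (C192, C193 from the book's inputs outright; C86 only given the node).

**v4: the thirty-second tranche (the level-one line: users of Chenevier – Lannes, Chenevier – Renard, Chenevier – Taïbi and
Taïbi; and Manji on GU(2,1)).**  Five more rows of the second-order censuses (`DOWNSTREAM.md` blocks `[g4]`, `[g5]`; never
typed) and one hypothesis node.  C93 (Bergström – Faber, Épijournal Géom. Algébrique 7 (2023)): every result is stated
under the authors' Galois hypothesis `conj-gal` (node `BFgal`) and uses the Chenevier – Lannes classification of the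
level-one algebraic cuspidal π of PGL_n of motivic weight ≤ 22 (restated as their Theorem 1 = row C5's starred statement)
and Taïbi's dimension formulae (row C4); no citation of the book — edge ⇐ C5 ∧ C4 ∧ node.  C94 (Shmakov 2023, PREPRINT):
the part of its Theorem 5.3 the author declares « unconditional for 1 ≤ n ≤ 3 on the basis of point counts » through « the
classification results of Chevevier-Taïbi » [sic] (row C6) and Taïbi's vanishing of S_{a,b,c}(Γ(1)) (row C4) — edge ⇐
C6 ∧ C4.  C97 (Mégarbané, J. Théor. Nombres Bordeaux 30 (2018)): traces of Hecke operators on level-one automorphic forms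
of SO₇, SO₈, SO₉ and Satake parameters of the Chenevier – Renard representations, « en suivant Arthur [Art13] et
Chenevier-Renard [CR] », the Arthur–Langlands statement for SO_n « dû à Taïbi [Tai16] … Kaletha [Kal] et
Arancibia-Moeglin-Renard [AMR] », with the sentence « les résultats de [CR] ne sont plus conditionnels » — edge ⇐ book ∧
C3 (both starred kinds) ∧ A3 ∧ B1.  C113 (Mégarbané, J. Number Theory 186 (2018)): Hecke operators on even lattices of
determinant 2 in dimensions 23, 25 and a Gan–Gross–Prasad verification, with the standard parameters « déterminés dans
[CL] … et [CR] » and the same Taïbi / AMR sentence; the book only in the bibliography — edge ⇐ C5 ∧ C3 ∧ A3 ∧ B1.  C109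
(Manji, Q. J. Math. 76 (2025)): one divisibility of a rank-1 Iwasawa main conj. and Selmer bounds for GU(2,1), from
« Theorem 2.2 ([Mok15] and others) » (base change GU(2,1) ↔ GL₃ × GL₁: Mok's memoir directly) and the Euler system of
[LSZ21] (row C110) — edge ⇐ Mok ∧ C110.  Row C149 (Bergström – Dummigan – Farmer – Koutsoliotas) of the same line is NOT
typed: an experimental paper without a theorem statement.  Texts: corpus TeX / PDF text; for C94 also the arXiv source.
Publication status 2026-08 (Crossref): C93, C97, C113, C109 published as cited; C94 PREPRINT.  The published versions
were NOT compared with the arXiv texts read.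

**Deliberately not here.**  Any content of a node; any claim that a downstream theorem is true or false; the
downstream papers' own hypotheses other than the one typed node (`LSvanishing`); their published Arthur-free inputs
(Taylor, Laumon, Weissauer, Urban, Sorensen, Jorza, Pilloni's higher Hida theory, Harris, Andreatta–Iovita–Pilloni,
automorphy lifting, Kato, Skinner–Urban, local multiplicity one, the authors' own earlier Euler-system papers),
absorbed; no Mathlib, no `axiom`, no `sorry`, no `opaque`.  Exact leaf supports (the « only if » half) are left to
`DownstreamSupport3.lean` (a later §32).
-/

set_option autoImplicit false

namespace Literature.NumberTheory.Automorphic.Arthur2013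

namespace Downstream

/-! ## Twenty-ninth tranche (v1, unit `pub-arthur-down-g20`): the GSp(4) arithmetic line — rows C87 (Loeffler – Pilloni –
Skinner – Zerbes 2021), C88 (Loeffler – Zerbes 2020), C89 (Loeffler – Rivero 2024), C91 (Loeffler – Zerbes 2026), C86
(Loeffler – Zerbes, with the node `LSvanishing`), C82 (A. Weiss 2022), C83 (T. Yamauchi), C84 (Tsuzuki – Yamauchi 2026), C85
(Berger – Betina 2022)

Context (`DOWNSTREAM.md` block `[g4]` rows C82–C89, C91; this tranche `DOWNSTREAM2.md` block `[g20]`; texts staged under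
`HOME/pub-arthur-down-g20/primaries/`: corpus page files `paper-arxiv-<id>/pNNNN.txt` and, for C86–C89/C91, the arXiv e-print
sources `arxiv-<id>-src/*.tex`, sha256 in `SHA256SUMS`).  (i) Row C87: D. Loeffler – V. Pilloni – C. Skinner – S. L. Zerbes,
*Higher Hida theory and p-adic L-functions for GSp₄*, Duke Math. J. 170 (2021) = arXiv:1905.08779 (source `main.tex`, 2022
revision): Theorems A and B (p-adic spin L-functions for GSp₄ and GSp₄ × GL₂ in Klingen-ordinary families); the set-up
fixes Π globally generic, non-Saito–Kurokawa, and « Via the classification of cuspidal automorphic representations of GSp₄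
announced in [arthur04] and proved in [geetaibi18], this leaves exactly two possibilities » (Yoshida type / general type);
the theorem on coherent cohomology (`thm:cohcoh`, multiplicity one of Π_f′ in H^i of the Siegel threefold, stated with
\qed) « follows by standard methods from Arthur's classification ».  Edge ⇐ book ∧ A4.  (ii) Row C88: D. Loeffler – S. L.
Zerbes, *Euler systems with local conditions*, Adv. Stud. Pure Math. 86 (2020) = arXiv:1710.04956 — a survey formulating the
authors' Euler-system predictions; the one inheriting statement is the restated theorem of Urban (« [Corollary 1]{urban05} »:
for a Klingen-ordinary genus-2 weight-3 Siegel cusp eigenform, ρ_𝓕(G_{ℚ_p}) stabilises a plane) with Urban's « stable at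
∞ » hypothesis REMOVED « as a consequence of Arthur's classification … announced in [arthur04] and proved in
[geetaibi18] ».  Edge ⇐ book ∧ A4.  (iii) Row C89: D. Loeffler – Ó. Rivero, Q. J. Math. 75 (2024) = arXiv:2303.16114:
Theorem `thm:main` (Deligne-type algebraicity for L(π × σ, s) in region (D⁻)); « We may suppose without loss of generality
that π is tempered, since Arthur's classification of the discrete spectrum [arthur04, geetaibi18] shows that for
non-tempered π … »; §2's Theorem (coherent cohomology, \qed) « is a consequence of Arthur's classification »; the generic
member of the L-packet of π.  Edge ⇐ book ∧ A4.  (iv) Row C91: D. Loeffler – S. L. Zerbes, *A universal Euler system for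
GSp₄*, Forum Math. (2026) = arXiv:2411.12576 (source = the 2026 revision): Theorems A (`thm:equivariance`) and B
(`thm:nongeneric`); §3.1 « Endoscopic classification » (Arthur and Gee–Taïbi; « This is an instance of Arthur's
multiplicity formula (Theorem 7.4.1 of [geetaibi18]) »; the unique generic member, « See Remark 7.4.7 of [geetaibi18] »);
« Arthur's multiplicity formula shows that ξ_{Π_∞} must be trivial as well ».  Edge ⇐ book ∧ A4.  (v) Row C86: D. Loeffler
– S. L. Zerbes, *On the Birch–Swinnerton-Dyer conj. for modular abelian surfaces*, arXiv:2110.13102 (PREPRINT; source =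
v3, 2023): Theorem A (finiteness of A(ℚ) and Ш_{p^∞} for modular abelian surfaces with L(A,1) ≠ 0 under hypotheses
(2)–(7)) and Theorem B (Bloch–Kato-type vanishing of H¹_f for globally generic cuspidal π on GSp₄); §2's Theorem
(finiteness of ℚ(π), « follows from Arthur's classification … (see [arthur04, geetaibi18]) »); « The main result of [LPSZ1]
was the following » (= C87, Theorem A, restated as Theorem `thm:cycloL`); and the two sentences of §1.3 typed below — the
node `LSvanishing` and the status sentence.  Edge ⇐ book ∧ A4 ∧ C87 ∧ `LSvanishing`.  (vi) Row C82: A. Weiss, J. Lond.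
Math. Soc. 106 (2022) = arXiv:1802.08537 (corpus TeX): Theorems A (crystallinity and irreducibility of ρ_{π,l} for
low-weight π, 100 % of l) and B (residual irreducibility / image ⊇ Sp₄(𝔽_l)); §0.2 « Dependence on Arthur's
classification »: « rely crucially on Arthur's endoscopic classification for GSp₄, which was announced in [Arthur2004]. In
particular, we require the local-global compatibility results proven by Mok [mok2014galois] » (= C191).  Edge ⇐ book ∧ A4
∧ C191.  (vii) Row C83: T. Yamauchi, *Serre weights for GSp₄ over totally real fields*, arXiv:2006.07824 (PREPRINT):
Theorems 1.1–1.6 (potentially diagonalisable automorphic lifts, weight / level control, Serre weights, companion forms);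
« Thanks to [Mok] with [GeeT] we can attach π with Galois representations: Theorem 2.1. (cf. … Theorem 1.1 of [Mok] with
Theorem C of [Weiss]) » (= C191, C82); « By [GeeT] there exists a unique globally generic representation »; « Theorem
7.4.1 of [GeeT] » (switching archimedean types); « Theorem 4.0.1 of [T] » ([T] = Taïbi, JEMS 21 (2019) = row A3, the
Jacquet–Langlands step to the inner form compact at infinity).  Edge ⇐ book ∧ A4 ∧ A3 ∧ C191 ∧ C82.  (viii) Row C84: N.
Tsuzuki – T. Yamauchi, J. Théor. Nombres Bordeaux 38 (2026) = arXiv:2008.09852: Theorem 1.2 (= Thms (mt-a5), (mt-F20):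
automorphy of ρ̄_{ψ,2}|_{G_M} by a holomorphic Hilbert–Siegel cusp form of parallel weight 3, « see [Mok] for the
construction of ρ_{h,2} »); « Finally, we apply [GeeT] to switch infinite types of Π′ ».  Edge ⇐ book ∧ A4 ∧ C191 (Theorem
1.3, the GO(2,2) → GL₄ statement, is not typed).  (ix) Row C85: T. Berger – A. Betina, Ann. Inst. Fourier 72 (2022) =
arXiv:1902.05885: Theorem 1.2 (local geometry of the Siegel eigenvariety 𝓔_Δ at the Saito–Kurokawa point π_α: stability of
the 2-dimensional components; tangent-space bounds and smoothness when the Selmer group is 1-dimensional); §2.3 « Schmidt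
makes the consequences of Arthur's classification for GSp₄ explicit in [Schmidt] » (= C180: types (G), (Y), (B), (Q), (P));
§2.4 Prop. 2.10's inputs « proved by [Mok] … Mok [Mok] used Arthur's classification for GSp₄, whose proof was completed by
Gee-Taibi in [G-T] » with the footnote typed below.  Edge ⇐ book ∧ A4 ∧ C180 ∧ C191.  Published Arthur-free inputs absorbed
throughout (Taylor, Laumon, Weissauer, Urban, Sorensen 2010, Jorza 2012 — whose own use of the transfer to GL₄ is the same
A4 input —, Pilloni's higher Hida theory, Harris, Andreatta–Iovita–Pilloni, BLGGT / BGGT, Kato, Skinner–Urban,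
Mœglin–Waldspurger's and Rösner–Weissauer's local multiplicity one, Novodvorsky, the authors' own earlier [LSZ17], [LZ20],
[LRZ], [KLZ17]). -/

/-- Further downstream statements (rows C87, C88, C89, C91, C86, C82, C83, C84, C85 of the cell's `DOWNSTREAM.md`, block
`[g4]`) and one hypothesis node, as an arbitrary assignment of propositions; nothing about the content of a field is
assumed.  Quotations: `l.N "…"` = line N of the staged arXiv source; `pNNNN:Ln` = the staged corpus page file.
[cite: Arthur2013, downstream register of the cell, twenty-ninth tranche (structure only)] -/
structure Consumers29 where
  /-- C87: D. Loeffler – V. Pilloni – C. Skinner – S. L. Zerbes, *Higher Hida theory and p-adic L-functions for GSp₄*, Duke Math. J. 170 (2021) no. 18, 4033–4121, doi:10.1215/00127094-2021-0049 [cite: LoefflerPilloniSkinnerZerbes2021, Thms A and B (arXiv:1905.08779 source `arxiv-1905.08779-src/main.tex`) with Thm `thm:cohcoh`]: Theorem A l.215 "Suppose that either $d = r_1 - r_2 \ge 1$ or that $d = 0$ and Hypothesis \ref{hyp:non-vanish} holds. Then there exist two constants $\Omega^+_\Pi$, $\Omega^-_\Pi \in \CC^\times$, uniquely determined modulo $E^\times$,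 and a $p$-adic measure $\mu_{\Pi}$ on $\Zp^\times$, such that for all Dirichlet characters $\chi$ of $p$-power conductor and all integers $0 \le a \le d$, we have" [∫ x^a χ dμ_Π = (−1)^a R_p(Π,a,χ) · Λ(Π ⊗ χ⁻¹, (1−d)/2 + a) / Ω_Π^±] — for Π (l.211 "Let $\Pi$ be a cuspidal automorphic representation of $\GSp_4(\AA_\QQ)$ which is non-CAP, globally generic, and cohomological with coefficients in the algebraic representation of highest weight $(r_1, r_2)$, for some integers $r_1 \ge r_2 \ge 0$."); Theorem B l.224 "Then there is a constant $\Omega_\Pi^W$, uniquely determined modulo $E^\times$, and a $p$-adic measure $\mu_{\Pi \times \sigma}$ on $\Zp^\times$, such that for all Dirichlet characters $\chi$ of $p$-power conductor and all integers $0 \le a \le d'$, we have" […]; and the coherent-cohomology theorem l.1298 "If $\Pi$ is of general type, then for each $0 \le i \le 3$, $\Pif'$ appears with multiplicity 1 as a Jordan--H\"older factor of the $G(\Af)$-representations" [H^i(X_{G,ℚ}, [L_i](−D)) ⊗ ℂ and H^i(X_{G,ℚ}, [L_i]) ⊗ ℂ …] (stated with \qed). -/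
  LPSZ : Prop
  /-- C88: D. Loeffler – S. L. Zerbes, *Euler systems with local conditions*, in: Development of Iwasawa Theory — the Centennial of K. Iwasawa's Birth, Adv. Stud. Pure Math. 86 (2020) 1–26, doi:10.2969/aspm/08610001 [cite: LoefflerZerbes2020LocalConditions, §3.2 « Example B », the restated theorem of Urban with its Remark (arXiv:1710.04956 source `arxiv-1710.04956-src/main.tex`)]: l.472 "\begin{theorem}[{\cite[Corollary 1]{urban05}}]" / l.474 "\item[(i)] If $\cF$ is Siegel-ordinary, then $\rho_{\cF}(G_{\Qp})$ stabilises a line in $V_{\cF}$." / l.475 "\item[(ii)] If $\cF$ is Klingen-ordinary, then $\rho_{\cF}(G_{\Qp})$ stabilises a plane in $V_{\cF}$." for l.456 "We take $\cF$ a cuspidal Siegel modular eigenform of genus 2 and weight 3." — part (ii) as restated WITHOUT Urban's « stable at ∞ » hypothesis (the Remark in the edge's docstring); the survey's own predictions are expectations, not theorems, and are not typed. -/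
  LZUrban : Prop
  /-- C89: D. Loeffler – Ó. Rivero, *Algebraicity of L-values for GSp₄ × GL₂ and GSp₄ × GL₂ × GL₂*, Q. J. Math. 75 (2024) no. 2, 391–412, doi:10.1093/qmath/haae016 [cite: LoefflerRivero2024, Thm `thm:main` (arXiv:2303.16114 source `arxiv-2303.16114-src/regionD_algebraicity.tex`) with the unnumbered Theorem of §« Connection with other works »]: l.359 "Assume the weights of $(\pi, \sigma)$ are in case $(D^-)$, and the following local hypothesis holds:" / l.361 "\item For each prime $\ell$ (if any) such that $\sigma_\ell$ is supercuspidal, the central character of $\pi_\ell$ is a square in the group of characters of $\QQ_\ell^\times$." / l.363 "Then \cref{conj:algebraicity} holds for $\pi \times \sigma$, with a period of the form" [Ω(π × σ) = Ω^{(1)}(π) · ⟨h, h⟩] (Deligne-type algebraicity of the critical values of L(π × σ, s), π on GSp₄ cohomological, σ on GL₂; `conj:algebraicity` = the paper's Conj. 1.x, line comment below); and l.481 "Let $i=1,2$. If $\pi$ is of general type or of Yoshida type, then $\pi_{\fin}'$ appears with multiplicity one as a Jordan--H\"older factor of the $G(\AA_{\fin})$-representations" […] (\qed). -/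
  LoefflerRivero : Prop
  /-- C91: D. Loeffler – S. L. Zerbes, *A universal Euler system for GSp₄*, Forum Math. (2026), doi:10.1515/forum-2025-0062 [cite: LoefflerZerbes2026Universal, Thms A (= `thm:equivariance`) and B (= `thm:nongeneric`) (arXiv:2411.12576 source `arxiv-2411.12576-src/main.tex`, 2026 revision)]: Theorem A l.172 "Assume $\Pi_\ell$ is generic for all finite primes $\ell$. Then there is a class" [z_can^{[Π,q,r]}(χ) ∈ H¹(ℚ, V_Π^*(−q))] l.174 "with the following property: for all choices of $\uPhi \in \cS(\Af^4; \uchi^{-1})$, all $\xi \in \cH(G(\Af);\QQ)$, and all choices of modular parametrisation of $V_{\Pi}^*$, the image of $\LE^{[q,r]}(\uPhi \otimes \xi)$ in $H^1(\QQ, V_{\Pi}^*(-q))$ is a scalar multiple of $z_{\can}^{[\Pi, q, r]}(\uchi)$. Moreover, the scalar factor is given by an explicit product of local zeta-integrals." and Theorem B l.182 "Assume that the central character of $\Pi$ is a square in the group of Dirichlet characters. Then, if there is a finite prime $\ell$ such that $\Pi_\ell$ is non-generic, the projection of $\LE^{[q,r]}(\uPhi \otimes \xi)$ to the $\Pif^\vee$-isotypic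 component is zero for all choices of $\uPhi$ and $\xi$." — for l.167 "Let $\Pi$ be a cuspidal, non-CAP automorphic representation of $\GSp_4 / \QQ$ whose Archimedean component is cohomological with respect to the algebraic representation of highest weight $(r_1, r_2)$." (Theorem C is « proved in [LZ26] » and not typed). -/
  LZUniversal : Prop
  /-- HYPOTHESIS node, C86: the vanishing statements the authors name as an input of their explicit reciprocity law, outside the three DAGs and without a supplier edge — arXiv:2110.13102 source `arxiv-2110.13102-src/main.tex` (v3, 2023) l.345 "(Note that the proof of the explicit reciprocity law relies on the vanishing statements for Hecke eigenspaces in the rigid cohomology of certain strata in Siegel modular threefolds of Klingen level at $p$, formulated in \cite{LZ20}, whose proofs will appear in forthcoming work of Lan--Skinner." [cite: LoefflerZerbes2021, §1.3 (the Lan–Skinner vanishing statements)] -/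
  LSvanishing : Prop
  /-- C86: D. Loeffler – S. L. Zerbes, *On the Birch–Swinnerton-Dyer conj. for modular abelian surfaces*, arXiv:2110.13102 (2021, v3 2023; PREPRINT — zbMATH « Preprint », no Crossref journal record 2026-08) [cite: LoefflerZerbes2021, Thms A (= `thm:maintheorem`) and B (= `thm:mainBK`) (source `arxiv-2110.13102-src/main.tex`)]: Theorem A l.280 "Let $A/\QQ$ be an abelian surface, and suppose that $A$ satisfies the following hypotheses:" [(1) L(A,1) ≠ 0; (2) A generic, or A = Res_{K/ℚ} E …; (3) l.284 "$A$ is modular, associated to a cuspidal automorphic representation of $\GSp_4 / \QQ$."; (4) an odd χ₋ with L(A, χ₋, 1) ≠ 0; (5)–(7) on p: good ordinary reduction, big image, deformability] l.297 "Then $A(\QQ)$ and $\Sha_{p^\infty}(A / \QQ)$ are finite. If $A = \Res_{K / \QQ}(E)$, then $E(K)$ and $\Sha_{p^\infty}(E / K)$ are finite."  Theorem B l.325 "Let $\pi$ be a globally generic, cuspidal automorphic representation of $\GSp_4$, with $\pi_\infty$ a discrete-series or limit of discrete-series representation of infinitesimal character $(r_1 + 2, r_2 + 1; -r_1-r_2)$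 for some integers $r_1 \ge r_2 \ge -1$." [… conditions (1)–(4) for some p ≥ 3 …] l.332 "Let $j$ be an integer with $0 \le j \le r_1 - r_2$. If $L(\Pi, \tfrac{1-r_1+r_2}{2} + j) \ne 0$, then the Bloch--Kato Selmer group $H^1_{\mathrm{f}}(\QQ, V_p(\pi)^*(-1-r_2-j))$ vanishes." (with Thm `thm:BSD`, one inclusion of the Iwasawa main conj. `thm:IMC`, and the finiteness of ℚ(π), §2). -/
  LZBSD : Prop
  /-- C82: A. Weiss, *On the images of Galois representations attached to low weight Siegel modular forms*, J. Lond. Math. Soc. (2) 106 (2022) no. 1, 358–387, doi:10.1112/jlms.12576 [cite: WeissAriel2022Images, Thms A and B (corpus TeX `paper:arxiv-1802.08537` p0002:L16, L18, L35, L37)]: Theorem A — for π cuspidal on GSp₄(𝔸_ℚ) with π_∞ in the holomorphic limit of discrete series, not CAP or endoscopic, and ρ_{π,l} : G_ℚ → GSp₄(ℚ̄_l) its l-adic representation — "* If $\rho_{\pi, \l}$ is crystalline and $\l>2k-1$, then $\rho_{\pi,\l}$ is irreducible." / "* $\rho_{\pi,\l}$ is crystalline for a set of primes of Dirichlet density $1$."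 / "In particular, $\rho_{\pi, \l}$ is irreducible for $100\%$ of primes."  Theorem B (residual images, 𝓛 = the density-one set of crystalline primes): "* For all but finitely many primes $\l\in \LL$, $\orho_{\pi,\l}$ is irreducible." / "* If $\pi$ is not an automorphic induction or a symmetric cube lift, then for all but finitely many primes $\l\in \LL$, the image of $\orho_{\pi,\l}$ contains $\Sp_4(\Fl)$." -/
  WeissImages : Prop
  /-- C83: T. Yamauchi, *Serre weights for GSp₄ over totally real fields*, arXiv:2006.07824 (2020; PREPRINT — zbMATH « Preprint, arXiv:2006.07824 ») [cite: Yamauchi2020, Thms 1.1–1.6 (corpus TeX `paper:arxiv-2006.07824` p0004:L5, L29, L76; p0005: Thms 1.5, 1.6)]: "Theorem 1.1. Let $F$ be a totally real field and $p$ be an odd prime number." / "Let $\br:G_F\lra {\rm GSp}_4(\bF_p)$ be an irreducible continuous mod $p$ Galois representation." [ρ̄|_{G_{F(ζ_p)}} irreducible with adequate image; ρ̄ automorphic of regular weight] "Then there exists a $p$-adic Galois representation $\rho:G_F\lra {\rm GSp}_4(\bQ_p)$ such that" / "* $\rho|_{G_{F,v}}$ is potentially diagonalizable for each finite place $v$ above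 $p$;" / "* $\rho$ comes from a regular cuspidal automorphic representation of ${\rm GSp}_4(\A_F)$ of level potentially prime to $p$. Further if" […]; "Theorem 1.2. Let $F$ be a totally real field and $p$ be an odd prime number." […] "Then there exists a regular cuspidal automorphic representation $\pi$ of ${\rm GSp}_4(\A_F)$ of level $($resp. potentially$)$ prime to $p$" [with ρ̄_{π,ι_p} ≃ ρ̄ and prescribed crystalline types at v ∣ p] "Further, we can freely choose the types of $\pi$ among" / "L-packets at infinite places. In particular, $\pi_\infty=\otimes\pi_{v|\infty}\pi_v$ can be" / "the holomorphic discrete series representation."; Theorems 1.3–1.6 (weights of the lifts, the set W(ρ̄) of Serre weights, companion forms). -/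
  YamauchiSerre : Prop
  /-- C84: N. Tsuzuki – T. Yamauchi, *Automorphy of mod 2 Galois representations associated to the quintic Dwork family and reciprocity of some quintic trinomials*, J. Théor. Nombres Bordeaux 38 (2026) no. 1, 253–293, doi:10.5802/jtnb.1361 [cite: TsuzukiYamauchi2026, Thm 1.2 (= Thms (mt-a5), (mt-F20); corpus TeX `paper:arxiv-2008.09852` p0004:L58-L69)]: "Theorem 1.2. $($Theorem (mt-a5) and Theorem (mt-F20)$)$" / "Suppose that $K=F$ is a totally real field and $f_\psi$ is irreducible over $F$." [Gal(F_{f_ψ}/F) ≃ F₂₀, A₅ or S₅ with complex conjugations of type (2,2); [F:ℚ] even if A₅; M/F the attached totally real (at most quadratic) extension] "Then there exists a holomorphic Hilbert-Siegel Hecke eigen cusp form $h$ on $\mathcal{H}^d_2$ of parallel weight three such that" [ρ̄_{ψ,2}|_{G_M} ≃ ρ̄_{h,2}] "where $\br_{h,2}$ is the reduction of $2$-adic representation $\rho_{h,2}$ associated to $h$ (see [Mok] for" / "the construction of $\rho_{h,2})$." (Theorem 1.3, the GO(2,2) → GL₄ statement, is not typed). -/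
  TsuzukiYamauchi : Prop
  /-- C85: T. Berger – A. Betina, *On Siegel eigenvarieties at Saito–Kurokawa points*, Ann. Inst. Fourier 72 (2022) no. 3, 901–961, doi:10.5802/aif.3482 [cite: BergerBetina2022, Thm 1.2 (corpus TeX `paper:arxiv-1902.05885` p0004:L31-L38)]: "Theorem 1.2 (see .(noendoscopic) and .(mainthmsection))." / "Put $s=\dim \rH^{1}_{f,\unr}(\Q,\rho_f(k-1))$." / "* Assume that $k \geq 2$ and $({ \bf Reg})$. Then all the irreducible affinoids of $\cE_\Delta$ of dimension $2$ specializing to $\pi_\alpha$ are stable." / "* Assume that $k \geq 2$, $({ \bf Reg})$, $({ \bf BK})$ and $({ \bf St})$, and assume also when $k=2$ that $L_p(f_\alpha,\omega^{-1}_p,T=p) \ne 0$, then" / "$$2 \leq \dim \mathfrak{t}_{\pi_\alpha} \leq 1 +s^2 \text{ and } \dim \mathfrak{t}_{\pi_\alpha}^0 \leq s^2.$$" / "Moreover, if $\dim \rH^{1}_{f,\unr}(\Q,\rho_f(k-1))=1$, then $\cE_{\Delta}$ is smooth at $\pi_{\alpha}$, and the reducibility locus of the pseudo-character $\mathrm{Ps}_{\cT}:G_\Q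 \rightarrow \cO(\cE_{\Delta}) \to \cT$ is the closed irreducible smooth subscheme of $\Spec \cT$ of dimension $1$ associated to the Saito-Kurokawa lift of the ordinary Hida family $\mathcal{F}$ passing through $f_\alpha$, and it is even a principal Weil divisor of $\Spec \cT$." (𝓔_Δ the Siegel eigenvariety of paramodular tame level, π_α the p-stabilised Saito–Kurokawa lift of f_α). -/
  BergerBetina : Prop

variable (ν : Nodes) (μ : Mok2015.Nodes) (κ : KMSW2014.Nodes) (c : Consumers) (c₁₉ : Consumers19) (c₂₈ : Consumers28)
  (c₂₉ : Consumers29)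

-- Verbatim, kept out of docstrings by the docstring lint.  C91 (`arxiv-2411.12576-src/main.tex`) l.431 "\subsubsection*{Endoscopic classification} The automorphic representations contributing to the discrete spectrum $L^2_{\mathrm{disc}}(G, \chi)$ have been classified by Arthur and Gee--Ta\"ibi: see \cite{arthur04} for an overview, Conjecture 2.5.6 of \cite{geetaibi18} for a precise statement for arbitrary GSpin groups, and Theorem 7.4.1 for its proof in the case of $\operatorname{GSpin}_5 = \GSp_4$."; l.190 "In this setting, combining \cref{introtheorem:B} and Arthur's multiplicity formula implies that the construction of \cite{LSZ17} can only give nontrivial classes in the summand corresponding to the middle two Hodge--Tate weights, never in the other summand. This is consistent with the Beilinson--Bloch--Kato conjecture:"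
-- C86 (`arxiv-2110.13102-src/main.tex`) l.277 "In this paper, we prove a similar result for abelian surfaces $A$ over $\QQ$, although our result is conditional on several other conjectures (which we hope should be easier to attack than BSD itself)."; Thm `thm:BSD` l.1157 "In the above setting, if $L(A,1) \neq 0$, then" / l.1158 "\[ \operatorname{rank}_{\ZZ}\, A(\QQ)= 0,\]" / l.1159 "as predicted by the Birch--Swinnerton-Dyer conjecture; furthermore, $\Sha_{p^\infty}(A / \QQ)$ is finite."; l.1327 "This conjecture ought to be accessible using the methods of \cite{BCGP} (although it is a little stronger than the $R = T$ results actually proved in \emph{op.cit.})." (their Conj. on the Klingen eigenvariety, §8; not an input of Thms A/B as stated).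
-- C88 (`arxiv-1710.04956-src/main.tex`) l.87 "We briefly survey the known Euler systems, and recall a standard conjecture of Perrin-Riou predicting what kind of Euler system one should expect for a general Galois representation." (abstract: the survey's own content is predictive).
-- C89 (`arxiv-2303.16114-src/regionD_algebraicity.tex`): `conj:algebraicity` = the paper's Conj. 1.x (Deligne-type algebraicity of critical values, l.310 "\begin{conjecture}\label{conj:algebraicity}").
-- C85 (`paper:arxiv-1902.05885`) p0004:L21: "Open problem. Let $x(g)$ be a classical point of the Siegel eigenvariety $\cE_N$ of tame level $\Gamma(N)$, the principal congruence subgroup of level $N$. Is the map $\kappa: \cE_N \to \cW$ unramified at $x(g)$?" (the Andreatta–Iovita–Pilloni question the theorem answers at π_α).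
-- C83 (`paper:arxiv-2006.07824`): the paper's subject is the weight part of Serre-type conjectures for GSp₄; p0005:L85 "However, the conjectural weight due to Section 5 of [til her] has been formulated by raising".

/-- C87, the places the classification is invoked (`arxiv-1905.08779-src/main.tex`; corpus chunk `paper:arxiv-1905.08779` p0021:L9 with the macros dropped).  THE DICHOTOMY: l.1270 "We fix -- for the remainder of this paper -- a globally generic automorphic representation $\Pi$ of $\GSp_4(\AA_\QQ)$ whose component at $\infty$ is this discrete series representation. We also assume that $\Pi$ is not a Saito--Kurokawa lifting. Via the classification of cuspidal automorphic representations of $\GSp_4$ announced in \cite{arthur04} and proved in \cite{geetaibi18}, this leaves exactly two possibilities:" / l.1273 "\item (``Yoshida type'') $\Pi$ lifts to a non-cuspidal automorphic representation of $\GL_4$ of the form $\pi_1 \boxplus \pi_2$, where the $\pi_i$ are cuspidal automorphic representations of $\GL_2$ generated by holomorphic modular forms of weights $r_1 + r_2 + 4$ and $r_1 - r_2 + 2$ respectively." / l.1275 "\item (``General type'') $\Pi$ lifts to a cuspidal automorphic representation of $\GL_4$."  COHERENT COHOMOLOGY: l.1295 "The following result follows by standard methods from Arthur's classification:" (Theorem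 `thm:cohcoh`, stated with \qed and used for the construction throughout).  [arthur04] = l.2741 "\bibitem[Art04]{arthur04}" (J. Arthur, *Automorphic representations of GSp(4)*, 2004 — the announcement); [geetaibi18] = l.2793 "\bibitem[GT19]{geetaibi18}" (Gee–Taïbi, J. Éc. polytech. Math. 6 (2019) = row A4).  Premises: the book at all ranks (the register's resolution of [arthur04] for PGSp₄ ≅ SO₅, as in rows C90, C180, C191) and row A4.  No sentence on the status of [arthur04]/[geetaibi18] beyond « announced … proved » (grep conditional / fundamental lemma / unpublished: nothing on the classification).  Published Arthur-free inputs absorbed: Pilloni's higher Hida theory, Harris 2004, Taylor, Weissauer, Laumon, Urban, Tilouine, Moeglin–Waldspurger and Roberts–Schmidt (local theory), Novodvorsky / Piatetski-Shapiro zeta integrals, the authors' [LSZ17]. [cite: LoefflerPilloniSkinnerZerbes2021, §2.1–2.2 (source l.1270, l.1295)] -/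
def E_LPSZ : Prop := (∀ N, ν.Everything N) → c.GeeTaibi → c₂₉.LPSZ

/-- C88, the place the classification is invoked (`arxiv-1710.04956-src/main.tex`; corpus chunk `paper:arxiv-1710.04956` p0012:L20): the Remark after the restated theorem of Urban — l.480 "Urban proves (ii) under an additional technical condition, that the automorphic representation $\Pi$ generated by $\cF$ be ``stable at $\infty$'' (see Remark (i) \emph{loc.cit.}). This hypothesis can now be removed, as a consequence of Arthur's classification of cuspidal automorphic representations of $\operatorname{GSp}_4$, announced in \cite{arthur04} and proved in \cite{geetaibi18}."  This is the survey's only use of the classification and its only status statement (counter-direction: the dependence is treated as resolved; cell `GAPS.md` G-DN-14).  Premises: the book at all ranks and row A4 (as C87).  Published Arthur-free inputs absorbed: Urban 2005, Taylor, Weissauer, the authors' [LSZ17], Dimitrov–Januszewski–Raghuram. [cite: LoefflerZerbes2020LocalConditions, §3.2 Remark (source l.480)] -/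
def E_LZUrban : Prop := (∀ N, ν.Everything N) → c.GeeTaibi → c₂₉.LZUrban

/-- C89, the places the classification is invoked (`arxiv-2303.16114-src/regionD_algebraicity.tex`; corpus chunk `paper:arxiv-2303.16114` p0003:L31).  THE REDUCTION TO TEMPERED π: l.299 "We may suppose without loss of generality that $\pi$ is \emph{tempered}, since Arthur's classification of the discrete spectrum \cite{arthur04, geetaibi18} shows that for non-tempered $\pi$, the $L$-function can be expressed as a product of automorphic $L$-functions for $\GL_2$ and $\GL_2 \times \GL_2$, and the algebraicity properties of these $L$-values are well-understood."  THE GENERIC MEMBER: l.369 "we instead work with a non-holomorphic cusp form for $\GSp_4$ belonging to the unique \emph{globally generic} representation in the same $L$-packet as $\pi$, and an Eisenstein series pushed forward from $\GL_2 \times \GL_2$."  COHERENT COHOMOLOGY: l.478 "The following result is a consequence of Arthur's classification:" (the \qed Theorem typed in the field) and l.510 "It follows from the results of \cite{su-preprint}, together with Arthur's classification of discrete-series representations of $\GSp_4$, that the result in fact applies for all weights."  The authors' « unconditional » (l.369 "In particular, our results are unconditional, not depending on any non-vanishing assumptions on Fourier coefficients;") concerns non-vanishing hypotheses, not the classification;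 no sentence on the status of [arthur04, geetaibi18].  Premises: the book at all ranks and row A4.  Published Arthur-free inputs absorbed: Harris–Kudla, J. Su, Novodvorsky, Morimoto, Saha, Furusawa–Morimoto (cited for comparison), higher Hida / Coleman theory, the authors' [LPSZ1] (= C87) machinery. [cite: LoefflerRivero2024, §§1.2–1.3, 2 (source l.299, l.478, l.510)] -/
def E_LoefflerRivero : Prop := (∀ N, ν.Everything N) → c.GeeTaibi → c₂₉.LoefflerRivero

/-- C91, the places the classification is invoked (`arxiv-2411.12576-src/main.tex`, §3.1 « Automorphic representations »; corpus chunk `paper:arxiv-2411.12576` p0008:L11, p0009:L8 = an earlier arXiv version of the same sentences).  THE CLASSIFICATION (first sentence in the line comment above, it names GT's Conj. 2.5.6 for general GSpin): l.431 "They can be partitioned into global packets, one for each ``Arthur parameter'' $\tau$, which is a formal sum of $\chi$-self-dual cuspidal automorphic representations of $\GL_1$ and $\GL_2$ satisfying certain conditions." / l.437 "In the general-type case, every element in the global packet is automorphic, and has multiplicity 1 in the discrete spectrum." / l.439 "and the product $\sideset{}{'}\bigotimes_v \Pi_v$ is automorphic iff $\prod_v \xi_v = 1$ (and has multiplicity 1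 in this case). This is an instance of Arthur's multiplicity formula (Theorem 7.4.1 of \cite{geetaibi18})." / l.441 "In either case, each local packet contains a unique generic representation (whose associated character $\xi_{\Pi_v}$ is trivial); and the tensor product of these locally-generic representations is automorphic and globally generic (a \emph{a priori} stronger condition than being everywhere locally generic). See Remark 7.4.7 of \cite{geetaibi18}."  USED: l.483 "Since $\Pi$ is automorphic, Arthur's multiplicity formula shows that $\xi_{\Pi_\infty}$ must be trivial as well, implying that $\Pi_\infty$ must be $\Pi_\infty^W$." and l.187 "for any $\Pi$ satisfying our hypotheses, there will be a unique globally generic representation $\Pi_{\mathrm{gen}}$ in the same $L$-packet as $\Pi$, and $\Pi_{\mathrm{gen}}$ will have the same Galois representation as $\Pi$, so we may construct an Euler system for this Galois representation using $\Pi_{\mathrm{gen}}$ instead."  No sentence on the status of [arthur04]/[geetaibi18] (contrast C86 by the same authors).  Premises: the book at all ranks and row A4.  Published Arthur-free inputs absorbed: Mœglin–Waldspurger's and Rösner–Weissauer's local multiplicity one, Prasad / Emory–Takeda, Harris–Scholl, Taylor, Weissauer, the authors' [LSZ17], [LPSZ1] (= C87), [LRZ]. [cite: LoefflerZerbes2026Universal,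 §§1.1, 3.1, 3.3 (source l.431, l.439, l.483)] -/
def E_LZUniversal : Prop := (∀ N, ν.Everything N) → c.GeeTaibi → c₂₉.LZUniversal

/-- C86, the places the classification is invoked (`arxiv-2110.13102-src/main.tex`; corpus chunks `paper:arxiv-2110.13102` p0004:L13, p0006:L23).  STATUS SENTENCE (§1.3, continuing the node `LSvanishing`'s sentence): l.345 "It also relies on the endoscopic classification of $\GSp_4$ automorphic representations due to Arthur and Gee--Ta\"ibi, which uses certain cases of the fundamental lemma whose proofs have not yet appeared; see \cite[\S 1.4]{BCGP} for further details.)"  THE COEFFICIENT FIELD (§2, Theorem): l.452 "Then the coefficients of the $P_\ell(\pi, \ell^{-s})$ for $\ell \notin S$ generate a finite extension $\QQ(\pi) / \QQ$ (independent of the choice of $S$), and the finite part $\pi_{\mathrm{f}}$ is definable as a $\QQ(\pi)$-linear representation." / l.456 "This follows from Arthur's classification of discrete automorphic representations of $\GSp_4$ (see \cite{arthur04, geetaibi18}), together with the strong-multiplicity-one theorems for $\GL_n$ for $n = 1,2,4$."  MULTIPLICITY ONE IN FAMILIES (footnote to the higher-Coleman-theory argument): l.717 "but this can be relaxed, since the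 endoscopic classification of automorphic representations for $\GSp_4$ is now known.}"  THE INPUT C87: l.517 "The main result of \cite{LPSZ1} was the following." (Theorem `thm:cycloL` = l.519 "\begin{theorem}[{\cite[Theorem A]{LPSZ1}}]").  Premises: the book at all ranks and row A4 ([arthur04, geetaibi18]); row C87; the node `LSvanishing`.  [BCGP] (row C9) is cited for modularity examples and for the status details, not consumed by Theorems A/B as stated (modularity is hypothesis (3)); the authors' [LSZ17], [LZ20], [LRZ] and Barrera–Dimitrov–Williams absorbed (their use of the classification is the same A4 input). [cite: LoefflerZerbes2021, §§1.3, 2, 7 (source l.345, l.456, l.717)] -/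
def E_LZBSD : Prop := (∀ N, ν.Everything N) → c.GeeTaibi → c₂₉.LPSZ → c₂₉.LSvanishing → c₂₉.LZBSD

/-- C82, the places the classification is invoked (`paper:arxiv-1802.08537`, corpus TeX).  §0.2 « Dependence on Arthur's classification » (p0003:L9-L11): "The results of this paper rely crucially on Arthur's endoscopic classification for $\Gf$, which was announced in [Arthur2004]. In particular, we require the local-global compatibility results proven by Mok [mok2014galois], which rely on the existence of a transfer map between automorphic representations of $\Gf$ and of $\GL_4$." / STATUS: "A proof of Arthur's endoscopic classification has been given by Gee–Taïbi [geetaibi]. However, this work is itself dependent on [Arthur2013] and on the twisted weighted fundamental lemma, which was announced in [chaudouard-laumon], but whose proof is yet to appear."  §1.2 (the low-weight Galois representations, Theorem 3, proof; p0006:L14): "* A second construction, due to Mok [mok2014galois], extends the work of Sorensen [sorensen], and constructs an eigencurve for $\Gf$. As in the cohomological case, the downside of this construction is that it relies on unpublished work of Arthur (see Section (Arthur)). However, using this construction, Mok [mok2014galois] proves local-global compatibility at ramified primes up to semisimplification. Part (6) is due to Jorza [jorza2012], and also uses this construction." / "Finally, the fact that the Galois representation is valued in $\Gf(\Qlb)$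 is the result of the next section, and does not rely on Arthur's classification."; §1.1 (cohomological weight, Theorem 2; p0005:L58): "With the exception of parts 5 and 7, this theorem is known without Arthur's classification."  The transfer Π of π to GL₄ ("We denote by $\Pi$ the automorphic representation of $\GL_4(\AQ)$ which is the transfer of $\pi$ (see Section (Arthur)).") enters the statements (automorphic induction, symmetric cube lift).  Bibliography: [Arthur2013] = "[Arthur2013] James Arthur. \newblock {\em The endoscopic classification of representations}, volume~61 of {\em American Mathematical Society Colloquium Publications}. \newblock American Mathematical Society, Providence, RI, 2013. \newblock Orthogonal and symplectic groups."; [mok2014galois] = Mok, Compos. Math. 150 (2014) = row C191; [geetaibi] = row A4; [schmidt_cap] (R. Schmidt 2018, the CAP types reviewed « for completeness ») not bound.  Premises: the book at all ranks ([Arthur2013], and the register's resolution of [Arthur2004]), row A4, row C191.  Published Arthur-free inputs absorbed: Taylor 1991, Laumon, Weissauer, Ramakrishnan, Jorza 2012 (its own use of the transfer is the same input), Walji, BLGGT, Patrikis–Taylor, Gan–Takeda's local Langlands correspondence for GSp₄. [cite: WeissAriel2022Images, §§0.2, 1.1–1.2 (p0003, p0005, p0006 as located)] -/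
def E_WeissImages : Prop := (∀ N, ν.Everything N) → c.GeeTaibi → c₂₈.MokGSp4 → c₂₉.WeissImages

/-- C83, the places the classification is invoked (`paper:arxiv-2006.07824`, corpus TeX).  §1 (p0003:L61): "explained in Section (ARGSp). The anticipated Arthur's classification of automorphic representations for $GSp_4$" / "(over any number field)" / "is now available due to Gee-Taïbi [GeeT] and it follows from this that" / "the construction of $\rho_{\pi,\iota_p}$ is now" / "unconditional under the assumption explained in the second paragraph of p.472 in [GeeT]."  STATUS BY REFERENCE, Remark 1.7 (p0005:L93): "we apply the main results in [GeeT] and [T] which have been built upon" / "several assumptions in the trace formula $($see the second paragraph in p.472 of [GeeT]$)$." / "Therefore, our results are as unconditional as the results in [GeeT] and [T]."; p0006:L13 "we fully apply these powerful tools which are still conditional depending on the expected completion of" / "Arthur's classification (see [GeeT], [T]) and it would include some advantages rather than to consider general cases."  THE GALOIS REPRESENTATIONS (§2, p0008:L52): "Thanks to [Mok] with [GeeT] we can attach $\pi$ with Galois representations:" / "Theorem 2.1. (cf. Theorem 3.1 and Remark 3.3, Theorem 1.1 of [Mok] with Theorem C of [Weiss])" ([Mok] = Compos. Math. 150 (2014)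 = row C191; [Weiss] = row C82).  BASE CHANGE / TYPES AT ∞ / JACQUET–LANGLANDS: "By [GeeT] there exists a unique globally generic representation $\pi'$ such that" (p0009:L61); "By Theorem 7.4.1 of [GeeT] , we can freely switch the types of $\Pi$ among" / "L-packets at infinite places by Arthur's classification due to [GeeT]." (p0030:L69); "Arthur parameters for $\Pi'$ in terms of Arthur parameter described in Theorem 4.0.1 of [T]." (p0011:L20; [T] = "[T] O. Taïbi, Arthur's multiplicity formula for certain inner forms of special orthogonal and symplectic groups. J. Eur. Math. Soc. (JEMS) 21 (2019), no. 3, 839-871." = row A3).  Premises: the book at all ranks, rows A4, A3, C191, C82.  Published Arthur-free inputs absorbed: BLGGT / BGG / Gee–Geraghty automorphy lifting, Tilouine, Herzig–Tilouine, Sorensen, Taylor, Weissauer, Kisin, the author's explicit local lifts (§§9.3–9.4). [cite: Yamauchi2020, §§1, 2, 3, 7 and Rem. 1.7 (p0003, p0005, p0006, p0008, p0009, p0011, p0030 as located)] -/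
def E_YamauchiSerre : Prop :=
  (∀ N, ν.Everything N) → c.GeeTaibi → c.TaibiInner → c₂₈.MokGSp4 → c₂₉.WeissImages → c₂₉.YamauchiSerre

/-- C84, the places the classification is invoked (`paper:arxiv-2008.09852`, corpus TeX).  STATUS BY REFERENCE, Remark 1.6 (p0005:L27-L33): "In the course of the proof of Theorem (mt-automorphy), to obtain holomorphic forms we will apply" / "the results in [GeeT]." / "Note that the results in [GeeT] are conditional on the trace formula" / "$($see the second paragraph in p.472 of [GeeT]$)$." / the EXPLICIT UNCONDITIONAL VARIANT: "However, if we do not require holomorphic forms for automorphy, the proof of (mt-automorphy) shows unconditionally that there exists a" / "global generic regular algebraic cuspidal automorphic representation $\Pi$ of ${\rm GSp}_4(\A_M)$ such that" / "$\br_{\Pi,2}\simeq \br_{\psi,2}|_{G_M}$."  THE GALOIS REPRESENTATIONS (§4.1, p0010:L55): "Thanks to [Mok] with [GeeT] we can attach $\pi$ with Galois representations:" / "Theorem 4.1. (cf. Theorem 3.1 and Remark 3.3, Theorem 1.1 of [Mok])" ([Mok] = row C191); HOLOMORPHIC FORMS: "Conversely, if cuspidal automorphic representation $\pi$ of ${\rm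 GSp}_4(\A_F)$ is neither CAP nor endoscopic, one can associate such a form $h$ by using" / "[Wei3] for $F=\Q$ and [GeeT] in general." (p0010:L108); §6 (p0015:L12): "Finally, we apply [GeeT] to switch infinite types of $\Pi'$."  Premises: the book at all ranks, row A4, row C191.  Published Arthur-free inputs absorbed: Kim–Shahidi's symmetric cube, Weissauer [Wei3], Jacquet–Langlands (paritious Hilbert forms), BLGGT-type automorphy lifting, Khare–Wintenberger-type arguments, the authors' image computations. [cite: TsuzukiYamauchi2026, Rem. 1.6, §§4.1, 6 (p0005, p0010, p0015 as located)] -/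
def E_TsuzukiYamauchi : Prop := (∀ N, ν.Everything N) → c.GeeTaibi → c₂₈.MokGSp4 → c₂₉.TsuzukiYamauchi

/-- C85, the places the classification is invoked (`paper:arxiv-1902.05885`, corpus TeX).  §2.3 (p0010:L17): "Schmidt makes the consequences of Arthur's classification for ${\rm GSp}_4$ explicit in [Schmidt]. All cuspidal automorphic representations are either of type (G), (Y), (B), (Q), or (P). The latter three are CAP representations, with type (P) for the Siegel parabolic including the Saito-Kurokawa lifts. Type (Y) representations are endoscopic representations (“of Yoshida type”). Type (G) representations are “stable” in the sense that their transfer to ${\rm GL}_4$ stays cuspidal, and therefore their Galois representations are expected to be irreducible." ([Schmidt] = "[Schmidt] \bysame, \emph{Packet structure and paramodular forms}, Trans. Amer. Math. Soc. \textbf{370} (2018), no.~5, 3085--3112. \MR{3766842}" = row C180).  §2.4, THE INPUTS OF PROP. 2.10 with the STATUS FOOTNOTE (p0010:L30): "We have the following result on the local properties of $\rho_\pi$ at the primes $\ell \mid N$ (compare [urban]) proved by [Mok] (local-global compatibility up to Frobenius semi-simplification for type (G) representations) and [Sch] (monodromy rank 1). Mok [Mok] used Arthur's classification for ${\rm GSp}_4$,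 whose proof was completed by Gee-Taibi in [G-T][Note the comments at [G-T] about this result still being conditional on unpublished work of Arthur and cases of the twisted weighted fundamental lemma.]." ([Mok] = Compos. Math. 150 (2014) = row C191; [G-T] = row A4; [Sch] = Sorensen, Doc. Math. 15 (2010), absorbed; [A] = Arthur 2004 in the bibliography).  Premises: the book at all ranks (the register's resolution of [A]/[G-T]), rows A4, C180, C191.  Published Arthur-free inputs absorbed: Andreatta–Iovita–Pilloni's eigenvariety, Urban, Skinner–Urban, Kato, Bellaïche–Chenevier pseudo-characters, Sorensen 2010, p-adic Hodge theory. [cite: BergerBetina2022, §§2.3–2.4 (p0010 as located; bibliography p0036–p0037)] -/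
def E_BergerBetina : Prop :=
  (∀ N, ν.Everything N) → c.GeeTaibi → c₁₉.SchmidtParamodular → c₂₈.MokGSp4 → c₂₉.BergerBetina

/-- The twenty-ninth tranche of implications. [cite: LoefflerPilloniSkinnerZerbes2021, Thms A–B; LoefflerZerbes2020LocalConditions, §3.2; LoefflerRivero2024, Thm `thm:main`; LoefflerZerbes2026Universal, Thms A–B; LoefflerZerbes2021, Thms A–B; WeissAriel2022Images, Thms A–B; Yamauchi2020, Thms 1.1–1.6; TsuzukiYamauchi2026, Thm 1.2; BergerBetina2022, Thm 1.2 (each edge's source in its own docstring)] -/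
structure Implications29 : Prop where
  lpsz : E_LPSZ ν c c₂₉
  lzUrban : E_LZUrban ν c c₂₉
  loefflerRivero : E_LoefflerRivero ν c c₂₉
  lzUniversal : E_LZUniversal ν c c₂₉
  lzBSD : E_LZBSD ν c c₂₉
  weiss : E_WeissImages ν c c₂₈ c₂₉
  yamauchiSerre : E_YamauchiSerre ν c c₂₈ c₂₉
  tsuzukiYamauchi : E_TsuzukiYamauchi ν c c₂₈ c₂₉
  bergerBetina : E_BergerBetina ν c c₁₉ c₂₈ c₂₉

variable {ν μ κ c c₁₉ c₂₈ c₂₉}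

/-- C87 inherits every leaf of the book — directly and through A4 (Gee–Taïbi ⇐ book, via the twisted weighted FL's
supplier edge) — and nothing of Mok or KMSW. [cite: LoefflerPilloniSkinnerZerbes2021, Thms A–B (bookkeeping proved here)] -/
theorem lpsz_of_leaves (W : Implications29 ν c c₁₉ c₂₈ c₂₉) (I : Implications ν μ κ c) (A : BookInputs ν) : c₂₉.LPSZ :=
  W.lpsz A.everything (geeTaibi_of_leaves I A)

/-- C87 in conditional form, 2026 (no status sentence; « announced in [arthur04] and proved in [geetaibi18] »): granting
the book's internal derivations, supply edges and every PUBLISHED input, Theorems A and B are conditional on the 2024–2026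
preprint layer and on the general and the non-standard weighted fundamental lemmas. [cite: LoefflerPilloniSkinnerZerbes2021, §2.1 (bookkeeping proved here)] -/
theorem lpsz_conditional_form (W : Implications29 ν c c₁₉ c₂₈ c₂₉) (I : Implications ν μ κ c) (B : ν.BookEdges)
    (S : ν.SupplyEdges) (P : ν.PublishedLeaves) :
    ν.PreprintLeaves2026 → ν.WFL_general → ν.WFL_nonstandard → c₂₉.LPSZ :=
  fun hQ h6 h7 => lpsz_of_leaves W I ⟨B, S, P, hQ, ⟨h6, h7⟩⟩

/-- C88 (the restated theorem of Urban, hypothesis removed) inherits every leaf of the book, directly and through A4.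
[cite: LoefflerZerbes2020LocalConditions, §3.2 Remark (bookkeeping proved here)] -/
theorem lzUrban_of_leaves (W : Implications29 ν c c₁₉ c₂₈ c₂₉) (I : Implications ν μ κ c) (A : BookInputs ν) :
    c₂₉.LZUrban :=
  W.lzUrban A.everything (geeTaibi_of_leaves I A)

/-- C88 in conditional form, 2026, against « This hypothesis can now be removed »: the removal is conditional on the
2024–2026 preprint layer and on the general and the non-standard weighted fundamental lemmas. [cite: LoefflerZerbes2020LocalConditions, §3.2 Remark (bookkeeping proved here)] -/
theorem lzUrban_conditional_form (W : Implications29 ν c c₁₉ c₂₈ c₂₉) (I : Implications ν μ κ c) (B : ν.BookEdges)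
    (S : ν.SupplyEdges) (P : ν.PublishedLeaves) :
    ν.PreprintLeaves2026 → ν.WFL_general → ν.WFL_nonstandard → c₂₉.LZUrban :=
  fun hQ h6 h7 => lzUrban_of_leaves W I ⟨B, S, P, hQ, ⟨h6, h7⟩⟩

/-- C89 inherits every leaf of the book, directly and through A4. [cite: LoefflerRivero2024, Thm `thm:main` (bookkeeping proved here)] -/
theorem loefflerRivero_of_leaves (W : Implications29 ν c c₁₉ c₂₈ c₂₉) (I : Implications ν μ κ c) (A : BookInputs ν) :
    c₂₉.LoefflerRivero :=
  W.loefflerRivero A.everything (geeTaibi_of_leaves I A)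

/-- C89 in conditional form, 2026 (no status sentence on the classification; the paper's « unconditional » concerns
non-vanishing hypotheses). [cite: LoefflerRivero2024, §1.3 (bookkeeping proved here)] -/
theorem loefflerRivero_conditional_form (W : Implications29 ν c c₁₉ c₂₈ c₂₉) (I : Implications ν μ κ c)
    (B : ν.BookEdges) (S : ν.SupplyEdges) (P : ν.PublishedLeaves) :
    ν.PreprintLeaves2026 → ν.WFL_general → ν.WFL_nonstandard → c₂₉.LoefflerRivero :=
  fun hQ h6 h7 => loefflerRivero_of_leaves W I ⟨B, S, P, hQ, ⟨h6, h7⟩⟩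

/-- C91 inherits every leaf of the book, directly and through A4. [cite: LoefflerZerbes2026Universal, Thms A–B (bookkeeping proved here)] -/
theorem lzUniversal_of_leaves (W : Implications29 ν c c₁₉ c₂₈ c₂₉) (I : Implications ν μ κ c) (A : BookInputs ν) :
    c₂₉.LZUniversal :=
  W.lzUniversal A.everything (geeTaibi_of_leaves I A)

/-- C91 in conditional form, 2026 (no status sentence in the 2026 revision). [cite: LoefflerZerbes2026Universal, §3.1 (bookkeeping proved here)] -/
theorem lzUniversal_conditional_form (W : Implications29 ν c c₁₉ c₂₈ c₂₉) (I : Implications ν μ κ c) (B : ν.BookEdges)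
    (S : ν.SupplyEdges) (P : ν.PublishedLeaves) :
    ν.PreprintLeaves2026 → ν.WFL_general → ν.WFL_nonstandard → c₂₉.LZUniversal :=
  fun hQ h6 h7 => lzUniversal_of_leaves W I ⟨B, S, P, hQ, ⟨h6, h7⟩⟩

/-- C86 given the book at all ranks, rows A4 and C87, and the node `LSvanishing`. [cite: LoefflerZerbes2021, Thms A–B with §1.3 (bookkeeping proved here)] -/
theorem lzBSD_of_book_rows_and_hypothesis (W : Implications29 ν c c₁₉ c₂₈ c₂₉) (hν : ∀ N, ν.Everything N)
    (h₄ : c.GeeTaibi) (h₈₇ : c₂₉.LPSZ) (hLS : c₂₉.LSvanishing) : c₂₉.LZBSD :=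
  W.lzBSD hν h₄ h₈₇ hLS

/-- C86 from the book's inputs — directly, through A4 and through C87 — MODULO the node `LSvanishing` (the Lan–Skinner
vanishing statements, outside the three DAGs). [cite: LoefflerZerbes2021, Thms A–B (bookkeeping proved here)] -/
theorem lzBSD_of_leaves_and_hypothesis (W : Implications29 ν c c₁₉ c₂₈ c₂₉) (I : Implications ν μ κ c) (A : BookInputs ν)
    (hLS : c₂₉.LSvanishing) : c₂₉.LZBSD :=
  W.lzBSD A.everything (geeTaibi_of_leaves I A) (lpsz_of_leaves W I A) hLS

/-- C86 in conditional form, 2026, against the authors' own sentence (« uses certain cases of the fundamental lemma whose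
proofs have not yet appeared »): granting the book's internal derivations, supply edges, every PUBLISHED input and the
Lan–Skinner node, Theorems A and B are conditional on the 2024–2026 preprint layer and on the general and the non-standard
weighted fundamental lemmas — the register's resolution of « certain cases of the fundamental lemma ». [cite: LoefflerZerbes2021, §1.3 (bookkeeping proved here)] -/
theorem lzBSD_conditional_form (W : Implications29 ν c c₁₉ c₂₈ c₂₉) (I : Implications ν μ κ c) (B : ν.BookEdges)
    (S : ν.SupplyEdges) (P : ν.PublishedLeaves) (hLS : c₂₉.LSvanishing) :
    ν.PreprintLeaves2026 → ν.WFL_general → ν.WFL_nonstandard → c₂₉.LZBSD :=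
  fun hQ h6 h7 => lzBSD_of_leaves_and_hypothesis W I ⟨B, S, P, hQ, ⟨h6, h7⟩⟩ hLS

/-- C82 given the book at all ranks, row A4 and the conduit C191. [cite: WeissAriel2022Images, §0.2 (bookkeeping proved here)] -/
theorem weissImages_of_book_and_rows (W : Implications29 ν c c₁₉ c₂₈ c₂₉) (hν : ∀ N, ν.Everything N) (h₄ : c.GeeTaibi)
    (h₁₉₁ : c₂₈.MokGSp4) : c₂₉.WeissImages :=
  W.weiss hν h₄ h₁₉₁

/-- C82 inherits every leaf of the book — directly, through A4 and through C191 (Mok 2014 ⇐ book ∧ A4) — and nothing of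
Mok's memoir or KMSW. [cite: WeissAriel2022Images, Thms A–B (bookkeeping proved here)] -/
theorem weissImages_of_leaves (W : Implications29 ν c c₁₉ c₂₈ c₂₉) (X : Implications28 ν μ κ c c₁₉ c₂₈)
    (I : Implications ν μ κ c) (A : BookInputs ν) : c₂₉.WeissImages :=
  W.weiss A.everything (geeTaibi_of_leaves I A) (mokGSp4_of_leaves X I A)

/-- C82 in conditional form, 2026, against §0.2 (« dependent on [Arthur2013] and on the twisted weighted fundamental lemma …
whose proof is yet to appear », 2018/2022): granting the book's internal derivations, supply edges and every PUBLISHED input,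
Theorems A and B are conditional on the 2024–2026 preprint layer and on the general and the non-standard weighted fundamental
lemmas (the register's two open suppliers of the twisted weighted FL). [cite: WeissAriel2022Images, §0.2 (bookkeeping proved here)] -/
theorem weissImages_conditional_form (W : Implications29 ν c c₁₉ c₂₈ c₂₉) (X : Implications28 ν μ κ c c₁₉ c₂₈)
    (I : Implications ν μ κ c) (B : ν.BookEdges) (S : ν.SupplyEdges) (P : ν.PublishedLeaves) :
    ν.PreprintLeaves2026 → ν.WFL_general → ν.WFL_nonstandard → c₂₉.WeissImages :=
  fun hQ h6 h7 => weissImages_of_leaves W X I ⟨B, S, P, hQ, ⟨h6, h7⟩⟩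

/-- C83 given the book at all ranks and rows A4, A3, C191, C82. [cite: Yamauchi2020, §§1–2 with Rem. 1.7 (bookkeeping proved here)] -/
theorem yamauchiSerre_of_book_and_rows (W : Implications29 ν c c₁₉ c₂₈ c₂₉) (hν : ∀ N, ν.Everything N) (h₄ : c.GeeTaibi)
    (h₃ : c.TaibiInner) (h₁₉₁ : c₂₈.MokGSp4) (h₈₂ : c₂₉.WeissImages) : c₂₉.YamauchiSerre :=
  W.yamauchiSerre hν h₄ h₃ h₁₉₁ h₈₂

/-- C83 inherits every leaf of the book — directly and through A4, A3 (Taïbi ⇐ book ∧ AMR ∧ the inner stabilisation), C191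
and C82 — and nothing of Mok's memoir or KMSW. [cite: Yamauchi2020, Thms 1.1–1.6 (bookkeeping proved here)] -/
theorem yamauchiSerre_of_leaves (W : Implications29 ν c c₁₉ c₂₈ c₂₉) (X : Implications28 ν μ κ c c₁₉ c₂₈)
    (I : Implications ν μ κ c) (A : BookInputs ν) : c₂₉.YamauchiSerre :=
  W.yamauchiSerre A.everything (geeTaibi_of_leaves I A) (taibiInner_of_leaves I A) (mokGSp4_of_leaves X I A)
    (weissImages_of_leaves W X I A)

/-- C83 in conditional form, 2026, against Remark 1.7 (« our results are as unconditional as the results in [GeeT] and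
[T] »): granting the book's internal derivations, supply edges and every PUBLISHED input, Theorems 1.1–1.6 are conditional
on the 2024–2026 preprint layer and on the general and the non-standard weighted fundamental lemmas — the current content
of « the second paragraph in p.472 of [GeeT] » in the register's resolution. [cite: Yamauchi2020, Rem. 1.7 (bookkeeping proved here)] -/
theorem yamauchiSerre_conditional_form (W : Implications29 ν c c₁₉ c₂₈ c₂₉) (X : Implications28 ν μ κ c c₁₉ c₂₈)
    (I : Implications ν μ κ c) (B : ν.BookEdges) (S : ν.SupplyEdges) (P : ν.PublishedLeaves) :
    ν.PreprintLeaves2026 → ν.WFL_general → ν.WFL_nonstandard → c₂₉.YamauchiSerre :=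
  fun hQ h6 h7 => yamauchiSerre_of_leaves W X I ⟨B, S, P, hQ, ⟨h6, h7⟩⟩

/-- C84 inherits every leaf of the book — directly, through A4 and through C191. [cite: TsuzukiYamauchi2026, Thm 1.2 (bookkeeping proved here)] -/
theorem tsuzukiYamauchi_of_leaves (W : Implications29 ν c c₁₉ c₂₈ c₂₉) (X : Implications28 ν μ κ c c₁₉ c₂₈)
    (I : Implications ν μ κ c) (A : BookInputs ν) : c₂₉.TsuzukiYamauchi :=
  W.tsuzukiYamauchi A.everything (geeTaibi_of_leaves I A) (mokGSp4_of_leaves X I A)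

/-- C84 in conditional form, 2026, against Remark 1.6 (« the results in [GeeT] are conditional on the trace formula »):
Theorem 1.2 — the HOLOMORPHIC Hilbert–Siegel form — is conditional on the 2024–2026 preprint layer and on the general and
the non-standard weighted fundamental lemmas; the authors' generic variant is stated by them without [GeeT] and is not this
field. [cite: TsuzukiYamauchi2026, Rem. 1.6 (bookkeeping proved here)] -/
theorem tsuzukiYamauchi_conditional_form (W : Implications29 ν c c₁₉ c₂₈ c₂₉) (X : Implications28 ν μ κ c c₁₉ c₂₈)
    (I : Implications ν μ κ c) (B : ν.BookEdges) (S : ν.SupplyEdges) (P : ν.PublishedLeaves) :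
    ν.PreprintLeaves2026 → ν.WFL_general → ν.WFL_nonstandard → c₂₉.TsuzukiYamauchi :=
  fun hQ h6 h7 => tsuzukiYamauchi_of_leaves W X I ⟨B, S, P, hQ, ⟨h6, h7⟩⟩

/-- C85 inherits every leaf of the book — directly and through A4, C180 (Schmidt ⇐ book) and C191 (Mok ⇐ book ∧ A4).
[cite: BergerBetina2022, Thm 1.2 (bookkeeping proved here)] -/
theorem bergerBetina_of_leaves (W : Implications29 ν c c₁₉ c₂₈ c₂₉) (X : Implications28 ν μ κ c c₁₉ c₂₈)
    (Y : Implications19 ν μ κ c₁₉) (I : Implications ν μ κ c) (A : BookInputs ν) : c₂₉.BergerBetina :=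
  W.bergerBetina A.everything (geeTaibi_of_leaves I A) (schmidtParamodular_of_leaves Y A) (mokGSp4_of_leaves X I A)

/-- C85 in conditional form, 2026, against the footnote of §2.4 (« still being conditional on unpublished work of Arthur
and cases of the twisted weighted fundamental lemma », 2019/2022): granting the book's internal derivations, supply edges
and every PUBLISHED input, Theorem 1.2 is conditional on the 2024–2026 preprint layer and on the general and the
non-standard weighted fundamental lemmas. [cite: BergerBetina2022, §2.4 footnote (bookkeeping proved here)] -/
theorem bergerBetina_conditional_form (W : Implications29 ν c c₁₉ c₂₈ c₂₉) (X : Implications28 ν μ κ c c₁₉ c₂₈)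
    (Y : Implications19 ν μ κ c₁₉) (I : Implications ν μ κ c) (B : ν.BookEdges) (S : ν.SupplyEdges)
    (P : ν.PublishedLeaves) : ν.PreprintLeaves2026 → ν.WFL_general → ν.WFL_nonstandard → c₂₉.BergerBetina :=
  fun hQ h6 h7 => bergerBetina_of_leaves W X Y I ⟨B, S, P, hQ, ⟨h6, h7⟩⟩

/-- The Euler-system / p-adic L-function line displayed: C87, C88, C89, C91 from the book's inputs alone, and C86 modulo
its own node. [cite: LoefflerPilloniSkinnerZerbes2021, Thms A–B; LoefflerZerbes2020LocalConditions, §3.2; LoefflerRivero2024, Thm `thm:main`; LoefflerZerbes2026Universal, Thms A–B; LoefflerZerbes2021, Thms A–B (bookkeeping proved here)] -/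
theorem eulerSystemLine_of_book (W : Implications29 ν c c₁₉ c₂₈ c₂₉) (I : Implications ν μ κ c) (A : BookInputs ν) :
    (c₂₉.LPSZ ∧ c₂₉.LZUrban ∧ c₂₉.LoefflerRivero ∧ c₂₉.LZUniversal) ∧ (c₂₉.LSvanishing → c₂₉.LZBSD) :=
  ⟨⟨lpsz_of_leaves W I A, lzUrban_of_leaves W I A, loefflerRivero_of_leaves W I A, lzUniversal_of_leaves W I A⟩,
    fun hLS => lzBSD_of_leaves_and_hypothesis W I A hLS⟩

/-- The low-weight / mod-p Galois line displayed: C82, C83, C84, C85 from the book's inputs (and the edges of tranches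
1, 19, 28 for A3, A4, C180, C191). [cite: WeissAriel2022Images, Thms A–B; Yamauchi2020, Thms 1.1–1.6; TsuzukiYamauchi2026, Thm 1.2; BergerBetina2022, Thm 1.2 (bookkeeping proved here)] -/
theorem galoisGSp4_line29_of_book (W : Implications29 ν c c₁₉ c₂₈ c₂₉) (X : Implications28 ν μ κ c c₁₉ c₂₈)
    (Y : Implications19 ν μ κ c₁₉) (I : Implications ν μ κ c) (A : BookInputs ν) :
    c₂₉.WeissImages ∧ c₂₉.YamauchiSerre ∧ c₂₉.TsuzukiYamauchi ∧ c₂₉.BergerBetina :=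
  ⟨weissImages_of_leaves W X I A, yamauchiSerre_of_leaves W X I A, tsuzukiYamauchi_of_leaves W X I A,
    bergerBetina_of_leaves W X Y I A⟩

/-- All nine rows of the tranche from the book's inputs (Mok's memoir and KMSW occur in none of the edges), C86 modulo
the node `LSvanishing`. [cite: LoefflerZerbes2021, Thms A–B with the eight rows of `eulerSystemLine_of_book` and `galoisGSp4_line29_of_book` (bookkeeping proved here)] -/
theorem twentyninth_of_inputs_and_hypothesis (W : Implications29 ν c c₁₉ c₂₈ c₂₉) (X : Implications28 ν μ κ c c₁₉ c₂₈)
    (Y : Implications19 ν μ κ c₁₉) (I : Implications ν μ κ c) (A : BookInputs ν) (hLS : c₂₉.LSvanishing) :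
    (c₂₉.LPSZ ∧ c₂₉.LZUrban ∧ c₂₉.LoefflerRivero ∧ c₂₉.LZUniversal ∧ c₂₉.LZBSD) ∧
      (c₂₉.WeissImages ∧ c₂₉.YamauchiSerre ∧ c₂₉.TsuzukiYamauchi ∧ c₂₉.BergerBetina) :=
  ⟨⟨lpsz_of_leaves W I A, lzUrban_of_leaves W I A, loefflerRivero_of_leaves W I A, lzUniversal_of_leaves W I A,
      lzBSD_of_leaves_and_hypothesis W I A hLS⟩, galoisGSp4_line29_of_book W X Y I A⟩


/-! ## Thirtieth tranche (v2, unit `pub-arthur-down-g20`): the GSp(4) arithmetic line continued — rows C111, C114, C120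
(Shih-Yu Chen 2021 / 2022 / 2023), C127 (Lemma – Ochiai 2023), C119 (Le – Le Hung – Lee 2025), C112 (Wang – Wei – Yan – Yi
2026)

Context (`DOWNSTREAM.md` rows C111, C112, C114 `[g5]`, C119, C120, C127 `[g5b]`; this tranche `DOWNSTREAM2.md` block
`[g20b]`; texts staged under `HOME/pub-arthur-down-g20/primaries/` — corpus page dirs and, for C111 / C112, the arXiv
sources `arxiv-2110.06261-src/main.tex`, `arxiv-2310.17144-src/main.tex` (+ `main.bbl`)).  (i) Row C111: Shih-Yu Chen,
*On Deligne's conj. for symmetric sixth L-functions of Hilbert modular forms*, arXiv:2110.06261 (PREPRINT): Theorem 1.3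
(`T:main`: for Π non-CM cohomological on GL₂(𝔸_𝔽), 𝔽 ∩ ℚ(ζ₅) = ℚ and κ_v ≥ 6, the algebraicity statement of the paper's
Conj. 1.1 for the critical values of L(s, Π, Sym⁶ ⊗ χ), over Aut(ℂ/𝔽^Gal), resp. over Aut(ℂ) for parallel weight); inputs:
« By Arthur's multiplicity formula [Art13, Theorem 1.5.2], the automorphic representation Sym⁶(Π) ⊗ ω_Π⁻³ descend … to an
irreducible cuspidal automorphic representation Ψ′ of Sp₆(𝔸_𝔽) » (the book directly), « discrete automorphic by Arthur's
multiplicity formula for GSp₄(𝔸_𝔽) established by Gee and Taïbi [GT19, Theorem 7.4.1] » and « [GT19, Remark 7.4.7] »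
(A4), « The existence of descent is guaranteed by Arthur's multiplicity formula [Mok15] » (U(2,2): Mok).  Edge ⇐ book ∧
A4 ∧ Mok.  (ii) Row C114: Shih-Yu Chen, Forum Math. 34 (2022) = arXiv:2112.12978: Theorem 1.2 (the paper's Conj. 1.1 —
Deligne's, for L(m, Sym⁵(f) ⊗ χ) — for newforms of weight κ ≥ 6) and Theorem 1.3 (period relations for Sym³(f));
« The existence of the descent is a consequence of Arthur's multiplicity formula for GSp₄(𝔸) established by Gee and
Taïbi [GT2019] ».  Edge ⇐ book ∧ A4.  (iii) Row C120: Shih-Yu Chen, Adv. Math. 414 (2023) = arXiv:2101.07507: Theorem 1.4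
(the paper's Conj. 1.1 for L(s, Π, Sym⁴ ⊗ χ), Π on GL₂ over totally real 𝔽, κ_v ≥ 3), Theorems 1.5, 1.6 (algebraicity for
GSp₄ × GL₂ Rankin–Selberg and twisted Asai L-values); « if follows from the global multiplicity formula of Gee and Taïbi
[GT2019] that Ψ_hol appears in the automorphic discrete spectrum of GSp₄(𝔸_𝔽) » [sic]; « holomorphic and non-vanishing
at s=1 by [Mok2015] » / « by [Mok2015], L(s, Π ⊗ χ̃, As^{(−1)^{n−1}}) has a pole at s=1 ».  Edge ⇐ book ∧ A4 ∧ Mok.  (iv)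
Row C127: F. Lemma – T. Ochiai, Kyoto J. Math. 63 (2023) = arXiv:1806.02135: Theorem 1.4 (`main`: a stable cuspidal Π′
congruent mod 𝔓 to the endoscopic (Yoshida-type) Π when p divides the normalised adjoint L-value) — clause (3)
« the cuspidal representation Π′ is stable » is proved from « the classification of the discrete spectrum of GSp(4) …
proved in [gee-taibi] » ([arthur] = the 2004 announcement).  Edge ⇐ book ∧ A4.  (v) Row C119: D. Le – B. V. Le Hung –
H. Lee, *Serre weight conj.s for GSp₄*, arXiv:2510.04805 (PREPRINT): Theorem 1.1.1 (`thm:SWC`: W(r̄) = W^?(r̄) for r̄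
potentially diagonalisably automorphic, Taylor–Wiles, tamely ramified and 9-generic above p) and the modularity lifting
application; « By Arthur's multiplicity formula [BCGP], such π are exactly of the form π = ⊗′π_v where π_v is in the
L-packet for r|_{G_{ℚ_v}} » ([BCGP] = Publ. IHÉS 134 (2021) = row C9, whose §2 restates Gee–Taïbi), Galois
representations « By various works including [weissauer, sorensen-gsp4, gee-taibi] ».  Edge ⇐ book ∧ A4 ∧ C9.  (vi) Row
C112: X. Wang – Z. Wei – P. Yan – S. Yi, Mathematika 72 (2026) = arXiv:2310.17144: Theorems 1.1–1.3 (refined strong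
multiplicity one for paramodular newforms by T(p)-eigenvalues / standard-L coefficients / twisted central values);
« Using Arthur's work … Schmidt [Sch18, Sch20] first proves a strong multiplicity one result », « it follows from
[Arthur2004] (see also [Schmidt2018, pp. 3088-3089]) that there are six different types », « by [Schmidt2020, Corollary
5.4] only the type (P) … and the type (G) … could happen », « by [Schmidt2018, Theorem 1.1] the local representation at
each non-archimedean place is generic … unique in each local Arthur packet », « By [Schmidt2018, Theorem 2.6] »
([Schmidt2018] = TAMS 370 = row C180; [Schmidt2020] = Acta Arith. 194 = row C182).  Edge ⇐ book ∧ C180 ∧ C182.  Authors'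
conditionality wording on the classification: NONE in the six texts (C112's « conditional » propositions concern its own
Hypothesis H on Selberg orthogonality for GL_m, m ≥ 5).  Published Arthur-free inputs absorbed: Kim–Shahidi and Kim
(symmetric cube / fourth), Clozel–Thorne and Patrikis (C111's transfer to GSp₆ with [Art13]), BLGG potential automorphy,
Grobner–Lin, Harris, Morimoto, Raghuram–Shahidi, Jacquet–Shalika, Hida, Ghate, Chen–Ichino, Weissauer, Taylor, Urban's
congruence machinery, Gee–Herzig–Savitt / Herzig–Tilouine (conj.s proved, not inputs), Hamann–Lee torsion vanishing,
Soudry, Rösner–Weissauer, Kumar–Meher–Shankhadhar, the GL_m strong multiplicity one theorems. -/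

/-- Further downstream statements (rows C111, C114, C120, C127, C119, C112 of the cell's `DOWNSTREAM.md`, blocks
`[g5]`/`[g5b]`), as an arbitrary assignment of propositions; nothing about the content of a field is assumed.
[cite: Arthur2013, downstream register of the cell, thirtieth tranche (structure only)] -/
structure Consumers30 where
  /-- C111: Shih-Yu Chen, *On Deligne's conj. for symmetric sixth L-functions of Hilbert modular forms*, arXiv:2110.06261 (2021; PREPRINT — zbMATH « Preprint ») [cite: ChenShihYu2021Sym6, Thm 1.3 = `T:main` (source `arxiv-2110.06261-src/main.tex` l.326-l.330; the corpus PDF text `paper:arxiv-2110.06261` p0002:L72)]: l.327 "Assume $\F\cap\Q(\zeta_5)=\Q$ and $\kappa_v \geq 6$ for all archimedean places $v$ of $\F$." — then (1) the algebraicity statement of the paper's Conj. 1.1 (Deligne's, for the critical values of L(s, Π, Sym⁶ ⊗ χ), Π a non-CM cohomological cuspidal automorphic representation of GL₂(𝔸_𝔽) of weights κ_v, 𝔽 totally real) holds with Aut(ℂ) replaced by Aut(ℂ/𝔽^Gal); (2) l.330 "If we assume further that $\kappa_v = \kappa_w$ for all archimedean places $v,w$ of $\F$, then" it holds as stated (verbatim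 clauses in the line comment below). -/
  ChenSym6 : Prop
  /-- C114: Shih-Yu Chen, *On Deligne's conj. for symmetric fifth L-functions of modular forms*, Forum Math. 34 (2022) no. 3, 831–849, doi:10.1515/forum-2021-0278 (corpus TeX `paper:arxiv-2112.12978`) [cite: ChenShihYu2022Sym5, Thm 1.2 (p0003:L80, verbatim in the line comment below: the paper's Conj. 1.1 — Deligne's, for L(m, Sym⁵(f) ⊗ χ) — for elliptic newforms f of weight κ ≥ 6) and Thm 1.3 (p0003:L85)]: "Theorem 1.3." / "Assume $\kappa \geq 6$. There exists a constant $C_\infty \in \C^\times$, depending only on $\kappa$, such that for all $\sigma \in {\rm Aut}(\C)$, we have" [σ(p(Sym³(f),±) / (C_∞ · G(ω)⁸ · c^±(f)² · ⟨f,f⟩⁴)) = the same for ^σf] (period relations between the motivic periods of f and the Betti–Whittaker periods of Sym³(f) on GL₄). -/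
  ChenSym5 : Prop
  /-- C120: Shih-Yu Chen, *On Deligne's conj. for symmetric fourth L-functions of Hilbert modular forms*, Adv. Math. 414 (2023) 108860, doi:10.1016/j.aim.2023.108860 (corpus TeX `paper:arxiv-2101.07507`) [cite: ChenShihYu2023Sym4, Thm 1.4 (p0003:L69, verbatim in the line comment below: the paper's Conj. 1.1 for the critical values of L(s, Π, Sym⁴ ⊗ χ), Π cohomological cuspidal on GL₂(𝔸_𝔽), when κ_v ≥ 3 for all archimedean v), Thm 1.5 (p0004:L40) and Thm 1.6 (p0005:L8)]: "Theorem 1.5 (Theorem (T:RS))." / "Assume $\ell_{1,v} > -\kappa_{2,v} > \ell_{2,v} > -\kappa_{1,v} > \ell_{3,v}$ for all $v \in S_\infty$." / "Let $m+\tfrac{1}{2}$ be critical for $L(s,\itSigma \times \itPi)$." [σ-equivariance of L^{(∞)}(m+½, Σ × Π) over the stated periods, Σ on GL₃, Π on GL₂]; "Theorem 1.6 (Theorem (T:Asai 2))." / "Assume $\itPi$ and $\itSigma$ are essentially conjugate self-dual." [algebraicity of L^{(∞)}(1, Π, As^± ⊗ χ) and L^{(∞)}(1, Σ, As^− ⊗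 η)]. -/
  ChenSym4 : Prop
  /-- C127: F. Lemma – T. Ochiai, *Endoscopic congruences modulo adjoint L-values for GSp(4)*, Kyoto J. Math. 63 (2023) no. 2, 281–333, doi:10.1215/21562261-10428456 (corpus TeX `paper:arxiv-1806.02135`) [cite: LemmaOchiai2023, Thm 1.4 = `main` (p0004:L21-L44) with Thm 1.3 (p0004:L4)]: "Theorem 1.4 (Theorem (main))." / "In addition to the setting given above, assume further that $p$ is prime to $N$ and is outside the finite set $S''_{\mathrm{tors}}$ which is defined by (s”-tors). Assume the following conditions:" [(a) ρ̄_{f₁}, ρ̄_{f₂} irreducible; (b) 𝔭 ∤ c′(f₁) c′(f₂); (c) p divides the normalised product of adjoint L-values L(1, ^σΠ, Ad)] "Then, there exists a prime divisor $\mathfrak{P}$ of $p$ in $\overline{\Q}$ and a cuspidal representation $\Pi' \simeq \bigotimes_v' \Pi'_v$ of $G(\A)$ such that" / "(3) the cuspidal representation $\Pi'$ is stable," / "(4) we have $\Pi' \not\simeq \,^\sigma\!\,\Pi$ for all $\sigma \in \mrm{Aut}(\C)$," / "(5) we have $\Pi' \equiv \Pi \pmod{\mathfrak{P}}$." (Π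 the endoscopic, globally generic cuspidal representation of GSp(4, 𝔸) attached to a pair (f₁, f₂) of elliptic newforms; Thm 1.3 = the adjoint-L-value formula for the discriminant d(Π_f)). -/
  LemmaOchiai : Prop
  /-- C119: D. Le – B. V. Le Hung – H. Lee, *Serre weight conj.s for GSp₄* (exact title in the line comment below), arXiv:2510.04805 (2025; PREPRINT) (corpus TeX `paper:arxiv-2510.04805`) [cite: LeLeHungLee2025, Thm 1.1.1 = `thm:SWC` (p0003:L19-L21)]: "Theorem 1.1.1 (Theorem (thm:SWC))." / "Suppose that $\rbar$ is potentially diagonalizably automorphic and satisfies the Taylor–Wiles conditions. If $\rbar$ is tamely ramified and $9$-generic" / "at all places above $p$, then $W(\rbar) = W^?(\rbar)$." (r̄ : G_F → GSp₄(𝔽̄_p), F totally real with p unramified; W(r̄) the Serre weights of r̄ in the étale cohomology of the Hilbert–Siegel modular variety, W^?(r̄) the Gee–Herzig–Savitt set), with the modularity lifting application ("As an application, we prove a modularity lifting theorem for $\GSp_4$ under similar assumptions."). -/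
  LeLeHungLee : Prop
  /-- C112: X. Wang – Z. Wei – P. Yan – S. Yi, *Some remarks on strong multiplicity one for paramodular forms*, Mathematika 72 (2026) no. 2, e70098, doi:10.1112/mtk.70098 (arXiv:2310.17144 source `arxiv-2310.17144-src/main.tex`, 2026 revision; corpus PDF text `paper:arxiv-2310.17144`) [cite: WangWeiYanYi2026, Thms 1.1–1.3 (source l.211, l.227, l.247)]: Theorem 1.1 l.212 "Let $(k_i, j_i)\in\Z_{>0}\times\Z_{\geq 0}$ and $N_i\in\Z_{>0}$, and let $F_i\in \mathcal{S}_{k_i, j_i}^{\mathrm{new}}(K(N_i))$ be two Hecke eigenforms for $i=1, 2$. For $\re(s)>3/2$, let " [L(s, π_{F_i}, ρ₄) = Σ a_{F_i}(n) n^{−s}] l.216 "be the associated spinor $L$-functions. If $a_{F_1}(p)=a_{F_2}(p)$ for almost all primes $p$, then $F_1=c\cdot F_2$ for some nonzero constant $c$."; Theorem 1.2 (standard L-functions, F_i « good », k_i ≥ 3) l.233 "be the associated standard $L$-functions. If $b_{F_1}(p)=b_{F_2}(p)$ for almost all primes $p$, then there exists a quadratic character $\chi$ such that $\pi_{F_1}\simeq\pi_{F_2}\otimes\chi$.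 Additionally, if we assume that $N_1$ and $N_2$ are squarefree numbers, then $F_1=c\cdot F_2$ for some nonzero constant $c$."; Theorem 1.3 l.248 "Let $F_i\in\mathcal{S}_{k_i}(\Gamma_2), i=1, 2$, be two Hecke eigenforms. Suppose that for almost all primitive characters $\chi$ of squarefree conductor, we have" [equal twisted central values L(1/2, π_{F_i} × χ, ρ₄ ⊗ σ₁)] l.252 "then $k_1=k_2$ and $F_1=c\cdot F_2$ for some nonzero constant $c$.    " -/
  WWYY : Prop

variable (ν : Nodes) (μ : Mok2015.Nodes) (κ : KMSW2014.Nodes) (c : Consumers) (c₁₉ : Consumers19) (c₂₀ : Consumers20)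
  (c₃₀ : Consumers30)

-- Verbatim, kept out of docstrings by the docstring lint.  C111 (`arxiv-2110.06261-src/main.tex`) Thm `T:main` l.329 "\item[(1)] Conjecture \ref{C:DC 2} holds with ${\rm Aut}(\C)$ replaced by ${\rm Aut}(\C/\F^{\Gal})$." / l.330 "\item[(2)] If we assume further that $\kappa_v = \kappa_w$ for all archimedean places $v,w$ of $\F$, then Conjecture \ref{C:DC 2} holds." (`C:DC 2` = l.303 "\begin{conj}[Deligne]\label{C:DC 2}"; corpus PDF text p0002:L72 "(1) Conjecture 1.1 holds with AutpCq replaced by AutpC{FGalq.").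
-- C114 (`paper:arxiv-2112.12978`) p0003:L69 "Conjecture 1.1 (Deligne)."; p0003:L80 "Theorem 1.2." / "If $\kappa \geq 6$, then Conjecture (C:Deligne) holds."; abstract p0002: "We prove Deligne's conjecture for symmetric fifth $L$-functions of elliptic newforms of weight greater than $5$."
-- C120 (`paper:arxiv-2101.07507`) p0003:L38 "Conjecture 1.1." / "Let $\chi$ be a finite order Hecke character of $\A_\F^\times$ with parallel signature."; p0003:L69 "Theorem 1.4." / "If $\kappa_v \geq 3$ for all archimedean places $v$ of $\F$, then Conjecture (C:Deligne) holds."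
-- C127 (`paper:arxiv-1806.02135`) p0028:L15 "let us assume that $\Pi'$ is not stable. According to the classification of the discrete spectrum of $\mathrm{GSp}(4)$ conjectured in [arthur], proved in [gee-taibi], this means that $\Pi'$ is either of Yoshida type, Saito-Kurokawa type, Howe Piatetski-Shapiro type or one-dimensional type."
-- C119 (`paper:arxiv-2510.04805`) exact title (corpus index.json): « Serre weight conjectures for $\mathrm{GSp}_4$ »; abstract p0002:L3 "We prove the weight part of Serre's conjecture for Galois representations valued in $\GSp_4$ that are tamely ramified with explicit genericity at places above $p$ as conjectured by Herzig–Tilouine and Gee–Herzig–Savitt."; p0003:L17 "If $\rbar$ is tame and generic at places above $p$, Gee–Herzig–Savitt defined an explicit set of Serre weights $W^?(\rbar)$ [GHS] to formulate a generalization of the weight part of Serre's conjecture. We confirm their conjecture under technical assumptions."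
-- C112 (`arxiv-2310.17144-src/main.tex`): the paper's own « conditional » (l.481 "\begin{proposition}\label{Strong MO for GL5 conditional}") refers to its Hypothesis H (Selberg orthogonality) for GL_m, m ≥ 5 — not to the classification.

/-- C111, the places the classification is invoked (`arxiv-2110.06261-src/main.tex`; corpus PDF text `paper:arxiv-2110.06261` p0021:L52, p0016:L70, p0032:L43, p0035:L30).  THE BOOK DIRECTLY (descent of Sym⁶ to Sp₆): l.1682 "By Arthur's multiplicity formula \cite[Theorem 1.5.2]{Arthur2013}, the automorphic representation ${\rm Sym}^6(\itPi) \otimes \omega_{\itPi}^{-3}$ descend, with respect to the standard representation ${\rm SO}_{7}(\C) \rightarrow \GL_7(\C)$, weakly to an irreducible cuspidal automorphic representation $\itPsi'$ of $\Sp_6(\A_\F)$ such that $\itPsi_v'$ is a discrete series representation for all $v \in S_\infty$." and l.346 "Based on the results of Arthur \cite{Arthur2013}, Clozel--Throne \cite{CT2017}, and Patrikis \cite{Patrikis2019}, in Proposition \ref{P:descent} we show that $\itPi$ transfer weakly to an $C$-algebraic irreducible cuspidal automorphic representation of $\GSp_6(\A_\F)$ with respect to the symmetric sixth power representation of $\GL_2(\C)$."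  GEE–TAÏBI (the Kim–Ramakrishnan–Shahidi lift on GSp₄): l.1324 "More precisely, the global Arthur parameter associated to $\itSigma'$ is of types (a) or (b) in the notation of \cite[Remark 6.1.8]{GT2019}." / l.1334 "Therefore, $\itSigma'$ and ${}^\sigma\!\itSigma$ belong to the same global Arthur packet. We then deduce that ${}^\sigma\!\itSigma$ is discrete automorphic by Arthur's multiplicity formula for $\GSp_4(\A_\F)$ established by Gee and Ta\"ibi \cite[Theorem 7.4.1]{GT2019}." / l.1336 "Finally, as explained in \cite[Remark 7.4.7]{GT2019}, among the global Arthur packet associated to $\itSigma'$, there is a unique globally generic discrete automorphic representation, which is characterized by the condition that it is locally generic at all places. Hence ${}^\sigma\!\itSigma$ must be globally generic." / l.2382 "Since the transfer of $\itSigma$ to $\GL_4(\A_\F)$ is cuspidal, it follows from Arthur's multiplicity formula proved by Gee and Ta\"{i}bi \cite[Theorem 7.4.1]{GT2019} that $\itSigma^{\rm hol}$ appears in the automorphic discrete spectrum of $\GSp_4(\A_\F)$."  MOK (the descent to U(2,2) in the period relation): l.2553 "The existence of descent is guaranteed by Arthur's multiplicity formula \cite{Mok2015}."  Bibliography: l.2672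 "\bibitem[Art13]{Arthur2013}", l.2816 "\bibitem[GT19]{GT2019}", l.2953 "\bibitem[Mok15]{Mok2015}".  Premises: the book at all ranks ([Art13] Theorem 1.5.2 for Sp₆, and the register's resolution of the GSp₄ classification), row A4, Mok's memoir at all ranks (U(2,2)).  No sentence on the status of any of the three (grep conditional / fundamental lemma / unpublished: 0 in the source).  Published Arthur-free inputs absorbed: Kim–Shahidi, Clozel–Thorne, Patrikis, BLGG, Clozel's purity lemma, Harris, Wallach, Grobner–Lin, Harris 2021, Morimoto, Liu, Jiang–Sun–Tian, the author's GSp₆ algebraicity (Theorem 3.2). [cite: ChenShihYu2021Sym6, §§1.2, 2, 3, 4, 5 (source l.1682, l.1334, l.2382, l.2553)] -/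
def E_ChenSym6 : Prop := (∀ N, ν.Everything N) → c.GeeTaibi → (∀ N, μ.Everything N) → c₃₀.ChenSym6

/-- C114, the place the classification is invoked (`paper:arxiv-2112.12978`, corpus TeX, p0009:L77): "Now we take $\itPsi$ be the descent of ${\rm Sym}^3 \itPi_1$ from $\GL_4(\A)$ to $\GSp_4(\A)$ with respect to the spin representation of $\GSp_4(\C)$. The existence of the descent is a consequence of Arthur's multiplicity formula for $\GSp_4(\A)$ established by Gee and Taïbi [GT2019]." ([GT2019] = row A4, bibliography p0017:L120).  The descent Ψ enters the period relation behind Theorems 1.2 / 1.3 (the GSp₄ × GL₂ algebraicity applied to Ψ × Π₂).  Premises: the book at all ranks (the register's resolution of the GSp₄ classification) and row A4.  No status sentence (grep conditional / fundamental lemma / unpublished: 0).  Published Arthur-free inputs absorbed: Kim–Shahidi's symmetric cube, Morimoto, the author's GSp₄ × GL₂ algebraicity [Chen2021f], Garrett–Harris, Raghuram, Januszewski. [cite: ChenShihYu2022Sym5, §3 (p0009 as located)] -/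
def E_ChenSym5 : Prop := (∀ N, ν.Everything N) → c.GeeTaibi → c₃₀.ChenSym5

/-- C120, the places the classification is invoked (`paper:arxiv-2101.07507`, corpus TeX).  GEE–TAÏBI (p0008:L39): "be an irreducible admissible representation of $\GSp_4(\A_\F)$ defined so that $\itPsi_{{\rm hol},v} = \itPsi_{{\rm gen},v}$ if $v$ is finite and $\itPsi_{{\rm hol},v}$ is the holomorphic discrete series representation in the $L$-packet of $\GSp_4(\F_v)$ containing $\itPsi_{{\rm gen},v}$ if $v \in S_\infty$. Since ${\rm Sym}^3\itPi$ is cuspidal, if follows from the global multiplicity formula of Gee and Taïbi [GT2019] that $\itPsi_{\rm hol}$ appears in the automorphic discrete spectrum of $\GSp_4(\A_\F)$." [sic « if follows »] ([GT2019] = row A4, bibliography p0046:L107).  MOK (the twisted Asai L-functions, Theorem 1.6 and the proof of the period relations; p0005:L5, p0036:L83): "Note that these $L$-functions are holomorphic and non-vanishing at $s=1$ by [Mok2015]." / "Therefore, by [Mok2015], $L(s,\itPi\otimes\tilde{\chi},{\rm As}^{(-1)^{n-1}})$ has a pole at $s=1$." ([Mok2015] = Mok's memoir, bibliography p0047:L12).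  Premises: the book at all ranks (the register's resolution of the GSp₄ classification), row A4, Mok's memoir at all ranks.  No status sentence (grep conditional / fundamental lemma / unpublished: 0).  Published Arthur-free inputs absorbed: Kim's symmetric cube / Kim–Shahidi, Ramakrishnan–Shahidi, Wallach, Raghuram, Grobner–Harris–Lin, Morimoto, Liu, Pitale–Saha–Schmidt (cited for comparison), the author's Whittaker-period machinery. [cite: ChenShihYu2023Sym4, §§1, 2.3, 5 (p0005, p0008, p0036 as located)] -/
def E_ChenSym4 : Prop := (∀ N, ν.Everything N) → c.GeeTaibi → (∀ N, μ.Everything N) → c₃₀.ChenSym4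

/-- C127, the place the classification is invoked (`paper:arxiv-1806.02135`, corpus TeX): the proof of clause (3) of Theorem 1.4 (§9, p0028:L15): "In the rest of the proof, we show that $\Pi'$ is stable under the conditions (a) and (b). In order to show this with contradiction," / […the classification of the discrete spectrum of GSp(4), announced in [arthur] and…] "proved in [gee-taibi], this means that $\Pi'$ is either of Yoshida type, Saito-Kurokawa type, Howe Piatetski-Shapiro type or one-dimensional type." (full sentence, whose elided words name [arthur]'s 2004 statement by its then status, in the line comment above); bibliography p0030:L9 "[arthur] J. Arthur, Automorphic representations of GSp(4), Contributions to automorphic forms, geometry and number theory, John Hopkins Univ. Press, Baltimore, MD, (2004), 65-81.", p0030:L38 "[gee-taibi] T. Gee, O. Taïbi, Arthur's multiplicity formula for $\mrm{GSp}_4$ and restriction to $\mrm{Sp}_4$, preprint, arXiv:1807.03988 [math.NT]."  Premises: the book at all ranks (the register's resolution of [arthur], as in rows C90, C180, C191) and row A4.  No status sentence (grep conditional / fundamental lemma / unpublished: only the authors' remark on [ichino] being an unpublished preprint refined by Chen–Ichino).  Published Arthur-free inputs absorbed: Hida, Ghate, Chen–Ichino (Petersson norm vs L(1, Π, Ad)),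 Weissauer (Galois representations, Yoshida lifts), Taylor, Urban, Roberts–Schmidt, the authors' discriminant computation. [cite: LemmaOchiai2023, §9, proof of Thm 1.4 (3) (p0028 as located)] -/
def E_LemmaOchiai : Prop := (∀ N, ν.Everything N) → c.GeeTaibi → c₃₀.LemmaOchiai

/-- C119, the places the classification is invoked (`paper:arxiv-2510.04805`, corpus TeX).  ARTHUR'S MULTIPLICITY FORMULA in the Breuil–Mézard multiplicity count (proof of Lemma `lem:factorizable-Minfty`, p0029:L27): "where the sum runs over cuspidal automorphic representations $\pi$ of $\GSp_4(\A_\Q)$ whose attached Galois representation is isomorphic to $r$ (viewed as $\Qpbar$-vector spaces via $\Qpbar\simeq \C$) and $W_{\pi^\infty}$ is a certain multiplicity space. By Arthur's multiplicity formula [BCGP], such $\pi$ are exactly of the form $\pi=\otimes'\pi_v$ where $\pi_v$ is in the $L$-packet for $r|_{G_{\Q_v}}$. Moreover, $\Hom_{\GSp_4(\Zp)}(\sig(\tau),\pi_p)$ is non-zero for a unique element in the $L$-packet of $r|_{G_{\Qp}}$ (see [lee_thesis])." ([BCGP] = "[BCGP] George Boxer, Frank Calegari, Toby Gee, and Vincent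 Pilloni, \emph{Abelian surfaces over totally real fields are potentially modular}, Publ. Math. Inst. Hautes \'{E}tudes Sci. \textbf{134} (20"[21] = row C9, p0031:L7).  THE GALOIS REPRESENTATIONS (p0003:L11): "We choose an isomorphism $\iota: \Qpbar \simeq \C$. By various works including [weissauer, sorensen-gsp4, gee-taibi], there is a Galois representation " ([gee-taibi] = row A4, p0031:L39).  Premises: the book at all ranks (the register's resolution of the GSp₄ classification), row A4 and row C9 (BCGP 2021, whose restatement of the multiplicity formula is the cited source; itself ⇐ A4 in the register).  No status sentence (a 2025 text; grep conditional / fundamental lemma / unpublished: 0).  Published Arthur-free inputs absorbed: Herzig–Tilouine, Gee–Herzig–Savitt, Le–Le Hung–Levin–Morra (Breuil–Mézard / local models), Hamann–Lee torsion vanishing, Lee's thesis, Weissauer, Sorensen, Taylor–Wiles patching (Calegari–Geraghty style), Enns–Lee. [cite: LeLeHungLee2025, §§1.1, 4.5 (p0003, p0029 as located)] -/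
def E_LeLeHungLee : Prop := (∀ N, ν.Everything N) → c.GeeTaibi → c.BCGP → c₃₀.LeLeHungLee

/-- C112, the places the classification is invoked (`arxiv-2310.17144-src/main.tex`; corpus PDF text `paper:arxiv-2310.17144` p0002:L10, p0007:L11).  §1: l.193 "However, it turns out that for holomorphic Siegel modular forms of degree $2$, the non-generic nature of the underlying archimedean representation prevents the direct application of standard techniques in automorphic forms. Using Arthur's work on a classification of the discrete automorphic spectrum in terms of automorphic representations of general linear groups, Schmidt \cite{Schmidt2018, Schmidt2020} first proves a strong multiplicity one result for holomorphic paramodular cusp forms of general level."  §2 « Arthur packets »: l.342 "Observing the exceptional isomorphism of the algebraic group $\PGSp_4$ with the split orthogonal group $\SO_5$, we can identify representations of $\SO_5(\A)$ with representations of $\PGSp_4(\A)$. Then it follows from \cite{Arthur2004} (see also \cite[pp.~3088-3089]{Schmidt2018}) that there are six different types of automorphic representations of $\PGSp_4(\A)$ in the discrete spectrum. Moreover, since we are interested in the paramodular forms, by \cite[Corollary~5.4]{Schmidt2020} only the type {\bf (P)} (consisting of Saito-Kurokawa liftings) and the type {\bf (G)} (the ``general" class, which are characterized by admitting a functorial transfer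 to a cuspidal automorphic representation of $\GL_4(\A)$) could happen in these forms, and only the type {\bf (G)} shows up if we consider the vector-valued paramodular forms."  PROOF OF THEOREM 1.1 (= `main thm 1`): l.686 "Then by the definition of Arthur packets, $\pi_{F_1}$ and $\pi_{F_2}\otimes\chi$ are in the same global Arthur packet and hence the same local Arthur packet for each local place." / l.688 "Since $F_1,F_2$ are paramodular newforms of type \text{{\bf (G)}}, by \cite[Theorem~1.1]{Schmidt2018} the local representation at each non-archimedean place is generic. Moreover, such generic local representation is unique in each local Arthur packet and hence $\pi_{F_1,p}\simeq\pi_{F_2,p}\otimes\chi_p$ for all finite places $p$." / l.688 "By \cite[Theorem~2.6]{Schmidt2018}, we have $\pi_{F_1}\simeq\pi_{F_2}\otimes\chi$ as cuspidal automorphic representations of $\GSp_4(\A)$. "  Bibliography (`main.bbl`): [Schmidt2018] = l.231 "\newblock {\em Trans. Amer. Math. Soc.}, 370(5):3085--3112, 2018." = row C180; [Schmidt2020] = l.235 "\newblock Paramodular forms in {CAP} representations of {${\rm GSp}(4)$}." / l.236 "\newblock {\em Acta Arith.}, 194(4):319--340, 2020." = row C182; [Arthur2004] = the 2004 announcement.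  Premises: the book at all ranks (the register's resolution of [Art04] for PGSp₄ ≅ SO₅), row C180, row C182 (the authors reach Arthur only through Schmidt and the announcement).  No sentence on the status of the classification.  Published Arthur-free inputs absorbed: Jacquet–Shalika / Moreno / Liu–Wang strong multiplicity one for GL_m, Soudry, Rösner–Weissauer, Kumar–Meher–Shankhadhar, Farmer–Pitale–Ryan–Schmidt, Roy–Schmidt–Yi (background), Radziwiłł–Yang. [cite: WangWeiYanYi2026, §§1, 2, 3.2 (source l.193, l.342, l.686)] -/
def E_WWYY : Prop := (∀ N, ν.Everything N) → c₁₉.SchmidtParamodular → c₂₀.SchmidtCAP → c₃₀.WWYY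

/-- The thirtieth tranche of implications. [cite: ChenShihYu2021Sym6, Thm 1.3; ChenShihYu2022Sym5, Thms 1.2–1.3; ChenShihYu2023Sym4, Thms 1.4–1.6; LemmaOchiai2023, Thm 1.4; LeLeHungLee2025, Thm 1.1.1; WangWeiYanYi2026, Thms 1.1–1.3 (each edge's source in its own docstring)] -/
structure Implications30 : Prop where
  chenSym6 : E_ChenSym6 ν μ c c₃₀
  chenSym5 : E_ChenSym5 ν c c₃₀
  chenSym4 : E_ChenSym4 ν μ c c₃₀
  lemmaOchiai : E_LemmaOchiai ν c c₃₀
  leLeHungLee : E_LeLeHungLee ν c c₃₀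
  wwyy : E_WWYY ν c₁₉ c₂₀ c₃₀

variable {ν μ κ c c₁₉ c₂₀ c₃₀}

/-- C111 given the book at all ranks, row A4 and Mok's memoir at all ranks. [cite: ChenShihYu2021Sym6, Thm 1.3 (bookkeeping proved here)] -/
theorem chenSym6_of_inputs_and_row (V : Implications30 ν μ c c₁₉ c₂₀ c₃₀) (hν : ∀ N, ν.Everything N) (h₄ : c.GeeTaibi)
    (hμ : ∀ N, μ.Everything N) : c₃₀.ChenSym6 :=
  V.chenSym6 hν h₄ hμ

/-- C111 inherits every leaf of the book — directly ([Art13, Thm 1.5.2] for Sp₆) and through A4 — and every leaf of Mok's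
memoir (the U(2,2) descent); nothing of KMSW. [cite: ChenShihYu2021Sym6, Thm 1.3 (bookkeeping proved here)] -/
theorem chenSym6_of_leaves (V : Implications30 ν μ c c₁₉ c₂₀ c₃₀) (I : Implications ν μ κ c) (A : BookInputs ν)
    (M : MokInputs μ) : c₃₀.ChenSym6 :=
  V.chenSym6 A.everything (geeTaibi_of_leaves I A) M.everything

/-- C111 in conditional form, 2026 (no status sentence): granting the book's and Mok's internal derivations, supply edges
and every PUBLISHED input, Theorem 1.3 is conditional on the 2024–2026 preprint layers of both monographs and on the
general and the non-standard weighted fundamental lemmas, once as the book's leaves and once as Mok's. [cite: ChenShihYu2021Sym6, §§2–5 (bookkeeping proved here)] -/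
theorem chenSym6_conditional_form (V : Implications30 ν μ c c₁₉ c₂₀ c₃₀) (I : Implications ν μ κ c) (B : ν.BookEdges)
    (S : ν.SupplyEdges) (P : ν.PublishedLeaves) (MB : μ.SectionEdges) (MS : μ.SupplyEdges) (MP : μ.PublishedLeaves) :
    ν.PreprintLeaves2026 → μ.PreprintLeaves2026 → ν.WFL_general → ν.WFL_nonstandard → μ.WFL_general →
      μ.WFL_nonstandard → c₃₀.ChenSym6 :=
  fun hQ hMQ h6 h7 m6 m7 => chenSym6_of_leaves V I ⟨B, S, P, hQ, ⟨h6, h7⟩⟩ ⟨MB, MS, MP, hMQ, ⟨m6, m7⟩⟩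

/-- C114 inherits every leaf of the book, directly and through A4; nothing of Mok or KMSW. [cite: ChenShihYu2022Sym5, Thms 1.2–1.3 (bookkeeping proved here)] -/
theorem chenSym5_of_leaves (V : Implications30 ν μ c c₁₉ c₂₀ c₃₀) (I : Implications ν μ κ c) (A : BookInputs ν) :
    c₃₀.ChenSym5 :=
  V.chenSym5 A.everything (geeTaibi_of_leaves I A)

/-- C114 in conditional form, 2026 (no status sentence; « established by Gee and Taïbi »): Theorems 1.2–1.3 are conditional
on the 2024–2026 preprint layer and on the general and the non-standard weighted fundamental lemmas. [cite: ChenShihYu2022Sym5, §3 (bookkeeping proved here)] -/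
theorem chenSym5_conditional_form (V : Implications30 ν μ c c₁₉ c₂₀ c₃₀) (I : Implications ν μ κ c) (B : ν.BookEdges)
    (S : ν.SupplyEdges) (P : ν.PublishedLeaves) :
    ν.PreprintLeaves2026 → ν.WFL_general → ν.WFL_nonstandard → c₃₀.ChenSym5 :=
  fun hQ h6 h7 => chenSym5_of_leaves V I ⟨B, S, P, hQ, ⟨h6, h7⟩⟩

/-- C120 inherits every leaf of the book (directly and through A4) and every leaf of Mok's memoir (the Asai poles);
nothing of KMSW. [cite: ChenShihYu2023Sym4, Thms 1.4–1.6 (bookkeeping proved here)] -/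
theorem chenSym4_of_leaves (V : Implications30 ν μ c c₁₉ c₂₀ c₃₀) (I : Implications ν μ κ c) (A : BookInputs ν)
    (M : MokInputs μ) : c₃₀.ChenSym4 :=
  V.chenSym4 A.everything (geeTaibi_of_leaves I A) M.everything

/-- C120 in conditional form, 2026 (no status sentence): Theorems 1.4–1.6 are conditional on the 2024–2026 preprint layers
of both monographs and on the general and the non-standard weighted fundamental lemmas, once as the book's leaves and
once as Mok's. [cite: ChenShihYu2023Sym4, §§1, 2.3 (bookkeeping proved here)] -/
theorem chenSym4_conditional_form (V : Implications30 ν μ c c₁₉ c₂₀ c₃₀) (I : Implications ν μ κ c) (B : ν.BookEdges)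
    (S : ν.SupplyEdges) (P : ν.PublishedLeaves) (MB : μ.SectionEdges) (MS : μ.SupplyEdges) (MP : μ.PublishedLeaves) :
    ν.PreprintLeaves2026 → μ.PreprintLeaves2026 → ν.WFL_general → ν.WFL_nonstandard → μ.WFL_general →
      μ.WFL_nonstandard → c₃₀.ChenSym4 :=
  fun hQ hMQ h6 h7 m6 m7 => chenSym4_of_leaves V I ⟨B, S, P, hQ, ⟨h6, h7⟩⟩ ⟨MB, MS, MP, hMQ, ⟨m6, m7⟩⟩

/-- C127 inherits every leaf of the book, directly and through A4; nothing of Mok or KMSW. [cite: LemmaOchiai2023, Thm 1.4 (bookkeeping proved here)] -/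
theorem lemmaOchiai_of_leaves (V : Implications30 ν μ c c₁₉ c₂₀ c₃₀) (I : Implications ν μ κ c) (A : BookInputs ν) :
    c₃₀.LemmaOchiai :=
  V.lemmaOchiai A.everything (geeTaibi_of_leaves I A)

/-- C127 in conditional form, 2026 (no status sentence; « proved in [gee-taibi] », 2018 / 2023): clause (3) of Theorem
1.4 — the stability of Π′ — is conditional on the 2024–2026 preprint layer and on the general and the non-standard
weighted fundamental lemmas. [cite: LemmaOchiai2023, §9 (bookkeeping proved here)] -/
theorem lemmaOchiai_conditional_form (V : Implications30 ν μ c c₁₉ c₂₀ c₃₀) (I : Implications ν μ κ c) (B : ν.BookEdges)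
    (S : ν.SupplyEdges) (P : ν.PublishedLeaves) :
    ν.PreprintLeaves2026 → ν.WFL_general → ν.WFL_nonstandard → c₃₀.LemmaOchiai :=
  fun hQ h6 h7 => lemmaOchiai_of_leaves V I ⟨B, S, P, hQ, ⟨h6, h7⟩⟩

/-- C119 given the book at all ranks, row A4 and row C9. [cite: LeLeHungLee2025, Thm 1.1.1 (bookkeeping proved here)] -/
theorem leLeHungLee_of_book_and_rows (V : Implications30 ν μ c c₁₉ c₂₀ c₃₀) (hν : ∀ N, ν.Everything N) (h₄ : c.GeeTaibi)
    (h₉ : c.BCGP) : c₃₀.LeLeHungLee :=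
  V.leLeHungLee hν h₄ h₉

/-- C119 inherits every leaf of the book — directly, through A4 and through C9 (BCGP ⇐ A4 ⇐ book) —; nothing of Mok or
KMSW. [cite: LeLeHungLee2025, Thm 1.1.1 (bookkeeping proved here)] -/
theorem leLeHungLee_of_leaves (V : Implications30 ν μ c c₁₉ c₂₀ c₃₀) (I : Implications ν μ κ c) (A : BookInputs ν) :
    c₃₀.LeLeHungLee :=
  V.leLeHungLee A.everything (geeTaibi_of_leaves I A) (bcgp_of_leaves I A)

/-- C119 in conditional form, 2026 (no status sentence in the 2025 text): the weight part of the Serre-type statement for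
GSp₄ as proved is conditional on the 2024–2026 preprint layer and on the general and the non-standard weighted fundamental
lemmas. [cite: LeLeHungLee2025, §4.5 (bookkeeping proved here)] -/
theorem leLeHungLee_conditional_form (V : Implications30 ν μ c c₁₉ c₂₀ c₃₀) (I : Implications ν μ κ c) (B : ν.BookEdges)
    (S : ν.SupplyEdges) (P : ν.PublishedLeaves) :
    ν.PreprintLeaves2026 → ν.WFL_general → ν.WFL_nonstandard → c₃₀.LeLeHungLee :=
  fun hQ h6 h7 => leLeHungLee_of_leaves V I ⟨B, S, P, hQ, ⟨h6, h7⟩⟩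

/-- C112 given the book at all ranks and the two Schmidt conduits C180, C182. [cite: WangWeiYanYi2026, Thms 1.1–1.3 (bookkeeping proved here)] -/
theorem wwyy_of_book_and_conduits (V : Implications30 ν μ c c₁₉ c₂₀ c₃₀) (hν : ∀ N, ν.Everything N)
    (h₁₈₀ : c₁₉.SchmidtParamodular) (h₁₈₂ : c₂₀.SchmidtCAP) : c₃₀.WWYY :=
  V.wwyy hν h₁₈₀ h₁₈₂

/-- C112 inherits every leaf of the book — directly and through C180 (Schmidt 2018 ⇐ book) and C182 (Schmidt 2020 ⇐ book ∧
C180) —; nothing of Mok or KMSW. [cite: WangWeiYanYi2026, Thms 1.1–1.3 (bookkeeping proved here)] -/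
theorem wwyy_of_leaves (V : Implications30 ν μ c c₁₉ c₂₀ c₃₀) (W : Implications20 ν c₁₉ c₂₀) (Y : Implications19 ν μ κ c₁₉)
    (A : BookInputs ν) : c₃₀.WWYY :=
  V.wwyy A.everything (schmidtParamodular_of_leaves Y A) (schmidtCAP_of_leaves W Y A)

/-- C112 in conditional form, 2026 (no status sentence): the refined strong multiplicity one theorems are conditional on the
2024–2026 preprint layer and on the general and the non-standard weighted fundamental lemmas. [cite: WangWeiYanYi2026, §2 (bookkeeping proved here)] -/
theorem wwyy_conditional_form (V : Implications30 ν μ c c₁₉ c₂₀ c₃₀) (W : Implications20 ν c₁₉ c₂₀)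
    (Y : Implications19 ν μ κ c₁₉) (B : ν.BookEdges) (S : ν.SupplyEdges) (P : ν.PublishedLeaves) :
    ν.PreprintLeaves2026 → ν.WFL_general → ν.WFL_nonstandard → c₃₀.WWYY :=
  fun hQ h6 h7 => wwyy_of_leaves V W Y ⟨B, S, P, hQ, ⟨h6, h7⟩⟩

/-- The four book-only rows of the tranche from the book's inputs (with tranches 1, 19, 20 for A4, C9, C180, C182).
[cite: ChenShihYu2022Sym5, Thm 1.2; LemmaOchiai2023, Thm 1.4; LeLeHungLee2025, Thm 1.1.1; WangWeiYanYi2026, Thm 1.1 (bookkeeping proved here)] -/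
theorem thirtieth_book_rows_of_book (V : Implications30 ν μ c c₁₉ c₂₀ c₃₀) (W : Implications20 ν c₁₉ c₂₀)
    (Y : Implications19 ν μ κ c₁₉) (I : Implications ν μ κ c) (A : BookInputs ν) :
    c₃₀.ChenSym5 ∧ c₃₀.LemmaOchiai ∧ c₃₀.LeLeHungLee ∧ c₃₀.WWYY :=
  ⟨chenSym5_of_leaves V I A, lemmaOchiai_of_leaves V I A, leLeHungLee_of_leaves V I A, wwyy_of_leaves V W Y A⟩

/-- All six rows of the tranche from the book's and Mok's inputs (KMSW occurs in no edge). [cite: ChenShihYu2021Sym6, Thm 1.3; ChenShihYu2023Sym4, Thm 1.4, with the four rows of `thirtieth_book_rows_of_book` (bookkeeping proved here)] -/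
theorem thirtieth_of_inputs (V : Implications30 ν μ c c₁₉ c₂₀ c₃₀) (W : Implications20 ν c₁₉ c₂₀)
    (Y : Implications19 ν μ κ c₁₉) (I : Implications ν μ κ c) (A : BookInputs ν) (M : MokInputs μ) :
    (c₃₀.ChenSym6 ∧ c₃₀.ChenSym4) ∧ (c₃₀.ChenSym5 ∧ c₃₀.LemmaOchiai ∧ c₃₀.LeLeHungLee ∧ c₃₀.WWYY) :=
  ⟨⟨chenSym6_of_leaves V I A M, chenSym4_of_leaves V I A M⟩, thirtieth_book_rows_of_book V W Y I A⟩

/-! ## Thirty-first tranche (v3, unit `pub-arthur-down-g20`): the GSp(4) arithmetic line — the explicit reciprocity law.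
Rows C192 (Loeffler – Zerbes, Cambridge J. Math. 14 (2026)) and C193 (Loeffler – Zerbes, quadratic Hilbert modular forms,
PREPRINT 2025), both NEW census rows (missed by censuses 2–19; found while searching for a supplier of row C86's node)

Context (this tranche `DOWNSTREAM2.md` block `[g20c]`; texts staged under `HOME/pub-arthur-down-g20/primaries/`: the arXiv
e-print sources `arxiv-2003.05960-src/spin_syntomic_CJM.tex` (v4 = the accepted version, 2026-04-21) and
`arxiv-2006.14491-src/main.tex` (v2, 2025-02-18), read-only GET of `https://arxiv.org/e-print/<id>`; the cell's corpus
texts `paper:arxiv-2003.05960` (an EARLIER version, 74 chunks) and `paper:arxiv-2006.14491` (v1, 37 chunks)).  (i) Row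
C192: Theorems A–D for Π non-endoscopic, non-CAP, globally generic on GSp₄/ℚ (set-up source l.283); inputs from the
register: the set-up « of general type in Arthur's classification (cf. [arthur04]) » and « (For more details see
[arthur04] and [geetaibi18].) » (l.469, l.473), Remark (iii) on the holomorphic member Π^H of the
global packet (l.486), and the p-adic L-function of [LPSZ1] = row C87 in the statement of Theorem A.  Edge ⇐ book ∧
A4 ∧ C87.  VERSION RECORD (verbatim in the line comments: docstring lint): the earlier versions made Theorem A depend on
vanishing statements for Hecke eigenspaces in rigid cohomology whose proof « has been found by Lan and Skinner and will
appear in a forthcoming paper » (corpus p0004, p0029) — the statements row C86 names (node `Consumers29.LSvanishing`,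
tranche 29); the version of record removes the dependence (l.367, l.2630, l.2064) and names C86 and
C193 as sequels (l.337).  No joint Lan – Skinner text is on arXiv (API author query 2026-08-19: 0 results).  (ii) Row
C193: Theorems A (`thm:withzeta`, l.244) and B (`thm:mainconj`, l.262) for π cuspidal on GL₂ over a
real quadratic field K (l.221), p split, π unramified ordinary above p; the Euler system « as an application of the
results of [LZ20] » (l.305), the coherent realisation, rationality theorem and p-adic L-function of [LPSZ1]
(l.1042, l.1070, l.1132), the Iwasawa classes of [LZ20] (l.1175); the twisted Yoshida lift
from Vignéras / Mokrane – Tilouine (l.1268), Arthur-free; the paper's sentence on Arthur's classification survives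
only as a TeX comment (l.996).  Edge ⇐ C87 ∧ C192 (no direct book premise).  Status sentence (l.300): about
the removed eigenspace statements, quoted in the edge docstring; nothing on the classification.  Row C86 is not
re-typed (its v3 of July 2023 still prints the dependence); `reciprocityLine_and_C86` records the contrast. -/

/-- Further downstream statements (NEW census rows C192, C193 of the cell's `DOWNSTREAM2.md`, block `[g20c]`), as an
arbitrary assignment of propositions; nothing about the content of a field is assumed.
[cite: Arthur2013, downstream register of the cell, thirty-first tranche (structure only)] -/
structure Consumers31 where
  /-- C192: D. Loeffler – S. L. Zerbes, *On the Bloch–Kato conj. for GSp(4)* (exact title in the line comment below), Cambridge J. Math. 14 (2026) no. 3, 603–784, doi:10.4310/CJM.260722230404 (arXiv:2003.05960v4 source `arxiv-2003.05960-src/spin_syntomic_CJM.tex`, the accepted version) [cite: LoefflerZerbes2026BlochKato, Thms A–D (source l.292, l.317, l.323, l.331)]: set-up l.283 "Let $\Pi$ be a non-endoscopic, non-CAP, globally generic automorphic representation of $G(\AA)$, of weights $(k_1,k_2)=(r_1+3,r_2+3)$ with $r_1,r_2\geq 0$, and write $V_\Pi$ for the 4-dimensional $p$-adic spin Galois representation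 of $\Pi$."  THEOREM A (`thm:main`) l.292 "Suppose $\Pi$ is unramified and Klingen-ordinary at $p$, and $r_1 - r_2 \ge 3$. Let $\nu$ be a basis of $\Gr^1 \DdR(V_{\Pi})$, and let $\nu_{\dR}$ be its unique lifting to a vector in $\Fil^1 \DdR(V_{\Pi})^{(\varphi - \alpha)(\varphi-\beta) = 0}$ (\cref{note:1diml}). Then we have" [⟨ν_dR, log_BK z^{[Π,q,r]}_can(χ)⟩ = (⋆) × 𝓛_{p,ν}(Π, χ; −1−r₂+q, r)] l.295 "for an explicit non-zero factor $(\star)$. Here, $\cL_{p}(\Pi, \bfj_1, \bfj_2)$ denotes the 2-variable spin $p$-adic $L$-function constructed in \cite{LPSZ1}."  THEOREM B (Π moreover Borel-ordinary, level one, r₁ − r₂ ≥ 6, big image) l.317 "There exists an Euler system for $V_\Pi^*(-1-r_2)$, whose image under the Perrin-Riou cyclotomic regulator map is the $p$-adic $L$-function $\cL_p(\Pi, \bfj)$."  THEOREM C l.323 "Assume that the above conditions are satisfied. Then the module $\wH^2_{\Iw}(\QQ(\mu_{p^\infty}), V)$ is torsion over the Iwasawa algebra, and its characteristic ideal divides the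 $p$-adic $L$-function $\cL_p(\Pi, \bfj)$."  THEOREM D l.331 "Assume that the above conditions are satisfied. Let $0\leq j\leq r_1-r_2$, and let $\rho$ be a finite-order character of $\Zp^\times$. If $L\left(\Pi\otimes \rho,\frac{1-r_1+r_2}{2}+j\right)\neq 0$, then $H^1_\mathrm{f}(\QQ,V(-j-\rho))=0$." -/
  LZBlochKato : Prop
  /-- C193: D. Loeffler – S. L. Zerbes, *Iwasawa theory for quadratic Hilbert modular forms*, arXiv:2006.14491v2 (2025; PREPRINT — no journal record 2026-08) (source `arxiv-2006.14491-src/main.tex`) [cite: LoefflerZerbes2025Hilbert, Thms A–B (source l.244, l.262)]: setting l.221 "Let $K$ be a real quadratic field, and let $\pi$ be a cuspidal automorphic representation of $\GL_2 / K$ of weight $(k_1, k_2, t_1, t_2)$, where $k_i, t_i$ are integers with $k_i \ge 2$ and $k_1 + 2t_1 = k_2 + 2t_2$."  THEOREM A (`thm:withzeta`), under (i) l.247 "\item $p$ is split in $K$." (ii) l.248 "\item $\pi$ is unramified and ordinary at the primes above $p$." (iii) central character through the norm, (iv) not a twisted base change, (v) big image: l.254 "Then the characteristic ideal of $\Ht^2_{\Iw}(K_\infty,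 \rho_{\pi, v}^*)$ divides $L_p(\pi)$ in $\Lambda_{\cO}(\Gamma)$." / l.256 "In particular, if $L_p(\pi)$ is not a zero-divisor, then $\Ht^2_{\Iw}(K_\infty, \rho_{\pi, v}^*)$ is torsion, and $\Ht^i_{\Iw}(K_\infty, \rho_{\pi, v}^*)$ vanishes for $i \ne 2$."  THEOREM B (`thm:mainconj`: parallel even weight, minimal ramification, with Wan's converse): l.273 "\[\Char_{\Lambda_{\cO}(\Gamma^1)} \Ht^2_{\Iw}(K^1_\infty, \rho_{\pi, v}^*) = \left(e_0 \cdot L_p(\pi) \right) \]" -/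
  LZHilbert : Prop

variable (ν : Nodes) (μ : Mok2015.Nodes) (κ : KMSW2014.Nodes) (c : Consumers) (c₁₉ : Consumers19) (c₂₈ : Consumers28)
  (c₂₉ : Consumers29) (c₃₁ : Consumers31)

-- Verbatim, kept out of docstrings by the docstring lint.  C192 exact title (source l.214): l.214 "\title{On the Bloch--Kato conjecture for $\GSp(4)$\protect\thanksref{T1}}".
-- C192 VERSION RECORD.  Version of record (v4 source): l.367 "\item In a previous version of the paper, steps (3) and (5) relied on the so-called \textit{eigenspace vanishing conjecture}. This is no longer the case: in step (3), we use instead an argument suggested to us by George Boxer and Vincent Pilloni (Section \ref{sect:BPproof}), and step (5) relies on a weaker result concerning Hecke eigenspaces in the rigid cohomology of the cuspidal boundary (c.f. Appendix \ref{chap:appendix})." / l.2630 "In an earlier draft of this paper, we gave a different argument for the existence of such a unique lifting, depending on an assertion (the ``Eigenspace Vanishing Conjecture'') describing the prime-to-$p$ Hecke eigenspaces appearing in the rigid cohomology of each stratum of $X_{\Kl, 0}$. The argument below replaces this ``prime-to-$p$'' information with (unconditional) information about the Frobenius action at $p$." / l.2064 "We expect that in fact $H^2_{\rig, c}(X_{\Kl,0}^m\langle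 -D\rangle, \cV)[\Pif'] = 0$; this was part of the ``eigenspace vanishing conjecture'' assumed in previous iterations of the present work. However, in the present account we do not need to know if this holds." / the removed remark survives as a TeX comment, l.302 "%  The proof of Theorem A relies on an assertion concerning the rigid cohomology of strata in the special fibre of a $\GSp_4$ Shimura variety, formulated as \cref{conj:eigenspaces} below. A proof of this statement has been found by Lan and Skinner and will appear in a forthcoming paper."
-- Earlier version (the cell's corpus text `paper:arxiv-2003.05960`): p0004:L27 "The proof of Theorem A relies on an assertion concerning the rigid cohomology of strata in the special fibre of a $\GSp_4$ Shimura variety, formulated as (conj:eigenspaces) below. A proof of this statement has been found by Lan and Skinner and will appear in a forthcoming paper."; p0029:L38 "We will need to assume the following conjecture, which will be proven in forthcoming work of Lan and Skinner:" / "Conjecture 10.2.3 (Eigenspace Vanishing Conjecture)."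
-- C192 sequels sentence (v4 l.337): l.337 "In sequels to this paper, \cite{LZ20-yoshida} and \cite{LZ21-BSD}, we relax the conditions on the weight and tame level of $\Pi$, and consider applications to the Iwasawa main conjecture for quadratic Hilbert modular forms, and to the Birch--Swinnerton-Dyer conjecture for modular abelian surfaces."
-- C193: v1 (corpus `paper:arxiv-2006.14491` p0004:L1) "We note that the results of this paper rely crucially on those of [LZ20], which in turn rely on an assertion regarding Hecke eigenspaces in rigid cohomology (the “eigenspace vanishing conjecture”, Conjecture 10.2.3 of op.cit.). This is not proven in op.cit., so at the time of writing our results are conditional; however, a programme to prove this conjecture has been developed by Lan and Skinner, so we anticipate that the results will become unconditional in due course."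
-- C193 v2 source, the sentence on the classification kept only as a TeX comment (l.996): l.996 "%It follows from Arthur's classification (cf.~\cite{geetaibi18}) that $\Pi \otimes \Pi_\infty^H$ and $\Pi \otimes \Pi_\infty^W$ have spectral multiplicity at most 1; and if $\Pi$ is not a functorial lift from $\GL_2 \times \GL_2$ or $\GL_2 \times \GL_1$, then both have multiplicity exactly 1, and moreover there is a unique globally generic representation which is isomorphic to $\Pi$ at almos"[…]

/-- C192, the places the classification is invoked (`arxiv-2003.05960-src/spin_syntomic_CJM.tex`, v4).  SET-UP §2.1 l.469 "We let $\Pi$ be a cuspidal automorphic representation of $G$, with finite-order central character $\chi_{\Pi}$, which is regular algebraic at $\infty$. We shall also suppose that $\Pi$ is \emph{of general type} in Arthur's classification (cf.~\cite{arthur04}), i.e.~its functorial lift to $\GL_4$ is cuspidal; and that $\Pi$ is \emph{globally generic} (has a non-vanishing Whittaker coefficient)." / l.473 "Moreover, the general-type automorphic representations may be partitioned into global ``packets'' in such a way that each packet contains a (unique) globally-generic representation. Since any two representations in the same global packet have the same Galois representation and the same $L$-function, we also lose no generality by supposing that $\Pi$ is globally generic. (For more details see \cite{arthur04} and \cite{geetaibi18}.)"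  REMARK (iii) l.486 "\item The representation $\Pi$ is not generated by holomorphic automorphic forms, but there exists a unique representation $\Pi^H$ in the same global packet as $\Pi$ such that $(\Pi^H)_\mathrm{f} = \Pif$ but $\Pi^H_\infty$ is a holomorphic discrete series."  THE p-ADIC L-FUNCTION of Theorem A is [LPSZ1]'s (row C87, whose Theorem `thm:cohcoh` « follows by standard methods from Arthur's classification »); Theorem B « relies on Theorem A not only for $\Pi$ itself, but also for all the classical specialisations of a $p$-adic family passing through $\Pi$ ».  Bibliography: l.6157 "\bibitem[Art04]{arthur04}" (the 2004 announcement), l.6313 "\bibitem[GT19]{geetaibi18}" (= row A4), [LPSZ1] = row C87.  Premises: the book at all ranks (the register's resolution of [arthur04]'s classification for GSp₄), row A4, row C87.  No sentence on the status of the classification (grep conditional / unconditional: only the version-record remarks on the removed eigenspace statements, line comments above).  Published Arthur-free inputs absorbed: Lemma–Flach–LSZ Euler system classes (LSZ17, JEMS 2021), higher Hida / Coleman theory (Pilloni, Boxer–Pilloni), Harris' occult periods, Piatetski-Shapiro's integral, Nekovář–Nizioł syntomic cohomology, Besser's finite-polynomial cohomology, Kings–Loeffler–Zerbes, Tilouine–Urban,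 Urban's eigenvariety, Rubin's Euler-system machine. [cite: LoefflerZerbes2026BlochKato, §2.1 and Rem. (iii) (source l.469, l.473, l.486)] -/
def E_LZBlochKato : Prop := (∀ N, ν.Everything N) → c.GeeTaibi → c₂₉.LPSZ → c₃₁.LZBlochKato

/-- C193, the places the register is reached (`arxiv-2006.14491-src/main.tex`, v2) — ONLY through rows C192 and C87: §1.2 l.305 "For $\pi$ with sufficiently regular weight, we construct this Euler system as an application of the results of \cite{LZ20}, using the ``twisted Yoshida lift'' -- an instance of Langlands functoriality, transferring automorphic representations from $"[…]; §5 l.1042 "As in \cite[\S 5.2]{LPSZ1}, we can realise (a suitable twist of) $\Pi$ over the number field $E$, as a direct summand of degree 2 coherent cohomology of the compactified $\GSp_4$ Shimura variety, giving a space" / l.1070 "We recall the following general rationality result for $\GSp_4$ spinor $L$-values, which is proved in \cite{LPSZ1}, building on the work of Harris in \cite{harris04}:" / l.1132 "We first recall the relevant $p$-adic $L$-function, which is an equivariant version of the construction of \cite{LPSZ1}." / l.1175 "In \cite{LZ20}, refining results in \cite{LSZ17}, we constructed a family of Iwasawa cohomology classes"; the twisted Yoshida lift itself: l.1268 "Follows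 from \cite[Theorem 6.2]{vigneras86} (see also \cite[\S 7.3]{mokranetilouine02}." [sic].  Bibliography: l.2692 "\bibitem[LZ24]{LZ20}" (= row C192), l.2667 "\bibitem[LPSZ21]{LPSZ1}" (= row C87).  The paper's own sentence on Arthur's classification is a TeX comment in the v2 source (line comment above) — no direct book premise is typed.  STATUS SENTENCE (the only one of the pair; about the eigenspace statements, not the classification): l.300 "\noindent\emph{Remark}: We note that the results of this paper rely crucially on those of \cite{LZ20}. Until recently, the results of that reference were conditional on an assertion regarding Hecke eigenspaces in rigid cohomology whose proof was to appear elsewhere. However, we have recently revised the preprint \cite{LZ20} to remove this dependence on forthcoming work; so the results of that paper, and hence of this one, are now unconditional."  Premises: row C87, row C192.  Published Arthur-free inputs absorbed: Vignéras 1986 / Mokrane–Tilouine (theta lift), Wan's converse divisibility, Hida theory for GL₂/K, Kings–Loeffler–Zerbes, Bertolini–Darmon–Prasanna, Nekovář. [cite: LoefflerZerbes2025Hilbert, §§1.2–1.3, 5 (source l.305, l.1042, l.300)] -/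
def E_LZHilbert : Prop := c₂₉.LPSZ → c₃₁.LZBlochKato → c₃₁.LZHilbert

/-- The thirty-first tranche of implications. [cite: LoefflerZerbes2026BlochKato, Thms A–D; LoefflerZerbes2025Hilbert, Thms A–B (each edge's source in its own docstring)] -/
structure Implications31 : Prop where
  lzBlochKato : E_LZBlochKato ν c c₂₉ c₃₁
  lzHilbert : E_LZHilbert c₂₉ c₃₁

variable {ν μ κ c c₁₉ c₂₈ c₂₉ c₃₁}

/-- C192 given the book's global theorems at all ranks and rows A4, C87. [cite: LoefflerZerbes2026BlochKato, Thms A–D (bookkeeping proved here)] -/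
theorem lzBlochKato_of_book_and_rows (Z : Implications31 ν c c₂₉ c₃₁) (hν : ∀ N, ν.Everything N) (h₄ : c.GeeTaibi)
    (h₈₇ : c₂₉.LPSZ) : c₃₁.LZBlochKato :=
  Z.lzBlochKato hν h₄ h₈₇

/-- C192 from the book's inputs (A4 through `geeTaibi_of_leaves`, C87 through `lpsz_of_leaves`); NO hypothesis node.
[cite: LoefflerZerbes2026BlochKato, Thms A–D (bookkeeping proved here)] -/
theorem lzBlochKato_of_leaves (Z : Implications31 ν c c₂₉ c₃₁) (W : Implications29 ν c c₁₉ c₂₈ c₂₉) (I : Implications ν μ κ c)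
    (A : BookInputs ν) : c₃₁.LZBlochKato :=
  Z.lzBlochKato A.everything (geeTaibi_of_leaves I A) (lpsz_of_leaves W I A)

/-- C192 in conditional form, 2026 (version of record; no status sentence on the classification): granting the book's
internal derivations, supply edges and every PUBLISHED input, Theorems A–D are conditional on the 2024–2026 preprint layer
and on the general and the non-standard weighted fundamental lemmas — through [arthur04] / [geetaibi18] and [LPSZ1].
[cite: LoefflerZerbes2026BlochKato, §2.1 (bookkeeping proved here)] -/
theorem lzBlochKato_conditional_form (Z : Implications31 ν c c₂₉ c₃₁) (W : Implications29 ν c c₁₉ c₂₈ c₂₉)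
    (I : Implications ν μ κ c) (B : ν.BookEdges) (S : ν.SupplyEdges) (P : ν.PublishedLeaves) :
    ν.PreprintLeaves2026 → ν.WFL_general → ν.WFL_nonstandard → c₃₁.LZBlochKato :=
  fun hQ h6 h7 => lzBlochKato_of_leaves Z W I ⟨B, S, P, hQ, ⟨h6, h7⟩⟩

/-- C193 given rows C87 and C192 (its only contacts with the register). [cite: LoefflerZerbes2025Hilbert, Thms A–B (bookkeeping proved here)] -/
theorem lzHilbert_of_rows (Z : Implications31 ν c c₂₉ c₃₁) (h₈₇ : c₂₉.LPSZ) (h₁₉₂ : c₃₁.LZBlochKato) : c₃₁.LZHilbert :=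
  Z.lzHilbert h₈₇ h₁₉₂

/-- C193 from the book's inputs, at THIRD order (through C87 and C192); no hypothesis node. [cite: LoefflerZerbes2025Hilbert, Thms A–B (bookkeeping proved here)] -/
theorem lzHilbert_of_leaves (Z : Implications31 ν c c₂₉ c₃₁) (W : Implications29 ν c c₁₉ c₂₈ c₂₉) (I : Implications ν μ κ c)
    (A : BookInputs ν) : c₃₁.LZHilbert :=
  Z.lzHilbert (lpsz_of_leaves W I A) (lzBlochKato_of_leaves Z W I A)

/-- C193 in conditional form, 2026, against the authors' own sentence « the results of that paper, and hence of this one,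
are now unconditional » (which concerns the eigenspace statements): as typed, Theorems A–B are conditional on the
2024–2026 preprint layer and on the general and the non-standard weighted fundamental lemmas, inherited through C87 and
C192. [cite: LoefflerZerbes2025Hilbert, §1.2 Remark (bookkeeping proved here)] -/
theorem lzHilbert_conditional_form (Z : Implications31 ν c c₂₉ c₃₁) (W : Implications29 ν c c₁₉ c₂₈ c₂₉)
    (I : Implications ν μ κ c) (B : ν.BookEdges) (S : ν.SupplyEdges) (P : ν.PublishedLeaves) :
    ν.PreprintLeaves2026 → ν.WFL_general → ν.WFL_nonstandard → c₃₁.LZHilbert :=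
  fun hQ h6 h7 => lzHilbert_of_leaves Z W I ⟨B, S, P, hQ, ⟨h6, h7⟩⟩

/-- Both rows of the tranche from the book's inputs (with tranches 1 and 29 for A4 and C87); Mok and KMSW occur in no
edge. [cite: LoefflerZerbes2026BlochKato, Thms A–D; LoefflerZerbes2025Hilbert, Thms A–B (bookkeeping proved here)] -/
theorem thirtyfirst_of_book (Z : Implications31 ν c c₂₉ c₃₁) (W : Implications29 ν c c₁₉ c₂₈ c₂₉) (I : Implications ν μ κ c)
    (A : BookInputs ν) : c₃₁.LZBlochKato ∧ c₃₁.LZHilbert :=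
  ⟨lzBlochKato_of_leaves Z W I A, lzHilbert_of_leaves Z W I A⟩

/-- THE CONTRAST, AS TYPED.  From the book's inputs the explicit reciprocity law of the version of record (C192) and its
Hilbert-modular sequel (C193) follow outright, while the BSD sequel C86 — whose latest text still names the vanishing
statements « whose proofs will appear in forthcoming work of Lan–Skinner » — follows only GIVEN its hypothesis node.
Nothing is adjudicated: the register types what each text prints. [cite: LoefflerZerbes2026BlochKato, Rem. after §1 strategy; LoefflerZerbes2021, §1.3; LoefflerZerbes2025Hilbert, §1.2 Remark (bookkeeping proved here)] -/
theorem reciprocityLine_and_C86 (Z : Implications31 ν c c₂₉ c₃₁) (W : Implications29 ν c c₁₉ c₂₈ c₂₉) (I : Implications ν μ κ c)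
    (A : BookInputs ν) : (c₃₁.LZBlochKato ∧ c₃₁.LZHilbert) ∧ (c₂₉.LSvanishing → c₂₉.LZBSD) :=
  ⟨thirtyfirst_of_book Z W I A, fun hLS => lzBSD_of_leaves_and_hypothesis W I A hLS⟩

/-! ## Thirty-second tranche (v4, unit `pub-arthur-down-g20`): the level-one line — rows C93 (Bergström – Faber 2023, with
the node `BFgal`), C94 (Shmakov 2023), C97 (Mégarbané, JTNB 2018), C113 (Mégarbané, JNT 2018) — and row C109 (Manji,
Q. J. Math. 2025) on GU(2,1)

Context (`DOWNSTREAM.md` rows C93, C94, C97 `[g4]`, C109, C113 `[g5]`; this tranche `DOWNSTREAM2.md` block `[g20d]`; texts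
staged under `HOME/pub-arthur-down-g20/primaries/` — corpus page dirs and, for C94, the arXiv source
`arxiv-2309.13806-src/main.tex`).  (i) Row C93: Theorems 6, 22, 26 (cohomology / Euler characteristics of 𝓐₃ with
local systems and of 𝓜_{3,n}, 𝓜̄_{3,n}), each stated under the authors' Galois hypothesis `conj-gal` (their Conj. 3,
node `BFgal`); inputs: the Chenevier – Lannes classification restated as their Theorem 1 (p0001:L32, L34) =
row C5's starred statement, and « By [Taibi] » (p0007:L3) = row C4; the book is not cited.  Edge ⇐ C5 ∧ C4
∧ node.  (ii) Row C94: the part of Theorem `Theorem3` (source l.857) declared unconditional for 1 ≤ n ≤ 3 (l.854)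
through « the classification results of Chevevier-Taïbi » [sic] (l.140, l.776; row C6) and Taïbi's vanishing of
S_{a,b,c}(Γ(1)) (l.778; row C4); the book is not cited.  Edge ⇐ C6 ∧ C4.  (iii) Row C97: Théorèmes 1.0.3–1.0.6 (p0004); « en
suivant Arthur [Art13] et Chenevier-Renard [CR] » (p0004:L3), Théorème 7.3.4 (p0035:L53, « dû à Taïbi
[Tai16] … Kaletha [Kal] et Arancibia-Moeglin-Renard [AMR] »), « les résultats de [CR] ne sont plus conditionnels »
(p0004:L17).  Edge ⇐ book ∧ C3 (★ and ★★) ∧ A3 ∧ B1.  (iv) Row C113: Théorèmes 1.0.1–1.0.5 (p0004–p0005); standard parameters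
« déterminés dans [CL] … et [CR] » (p0005:L11), the Arthur–Langlands statement for SO_n « vérifiée par Taïbi
[Tai16] … Kaletha [Kal] et Arancibia-Moeglin-Renard [AMR] » (p0009:L13); [Art13] only in the bibliography.
Edge ⇐ C5 ∧ C3 (★★) ∧ A3 ∧ B1.  (v) Row C109: Theorems 4.3, 5.1, 5.3 (pp. 10–13); « Theorem 2.2 ([Mok15] and others) »
(p0004:L20; Mok's memoir directly) and « Theorem 3.3 ([LSZ21], Theorem 12.3.1) » (p0006:L45; row C110).
Edge ⇐ Mok ∧ C110.  Status sentences on the classification: C97 asserts the opposite (« ne sont plus conditionnels »),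
the four others none (C94's « unpublished work of Taïbi » concerns the Bergström–Faber–van der Geer formula). -/

/-- Further downstream statements (rows C93, C94, C97, C113, C109 of the cell's `DOWNSTREAM.md`, blocks `[g4]`/`[g5]`)
and one hypothesis named by a downstream paper itself, as an arbitrary assignment of propositions; nothing about the
content of a field is assumed. [cite: Arthur2013, downstream register of the cell, thirty-second tranche (structure only)] -/
structure Consumers32 where
  /-- HYPOTHESIS node: Bergström – Faber's Galois hypothesis `conj-gal` (their Conj. 3, p0002:L26, verbatim in the line comment below: every semisimple geometric Galois representation of motivic weight ≤ 22 with non-negative Hodge–Tate weights is a sum of Tate twists of the eleven φ_j), under which EVERY theorem of row C93 is stated.  A paper's own named hypothesis, as `F4AMF`, `WZhyp`, `LSvanishing`; no supplier edge. [cite: BergstromFaber2023, Conj. 3 (p0002 as located)] -/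
  BFgal : Prop
  /-- C93: J. Bergström – C. Faber, *Cohomology of moduli spaces via a result of Chenevier and Lannes*, Épijournal Géom. Algébrique 7 (2023), Art. 20, doi:10.46298/epiga.2023.10307 (corpus TeX `paper:arxiv-2207.05130`) [cite: BergstromFaber2023, Thms 6, 22, 26 (p0003:L20, p0006:L87, p0007:L22; first sentences — the Galois hypothesis — in the line comment below)]: Theorem 6 "Let $\mathcal X$ be a smooth and proper Deligne–Mumford stack over $\Z$ of relative dimension $d$ at most $22$ with a given action of the symmetric group $\mathbb S_n$. Then the semisimplification of $H_{c,\mu}^i( \mathcal X \otimes \overline{\Q})$ is an element of $\mathbf \Phi_i$ for any $0 \leq i \leq d$ and partition $\mu$ of $n$." Theorem 22 "Then [BFvdG2] is true for all $\lambda$ such that $|\lambda| \leq 16$." (the Bergström–Faber–van der Geer formula for e_c(𝓐₃ ⊗ ℚ̄, 𝕍_λ)); Theorem 26 "For all partitions $\mu$ of $n \leq 14$, $e_{c,\mu}(\Mm_{3,n} \otimes \overline \Q )$ and $e_{c,\mu}(\overline{\Mm}_{3,n} \otimes \overline \Q )$ can be determined." -/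
  BergstromFaber : Prop
  /-- C94: A. Shmakov, *Cohomological arithmetic statistics for principally polarized abelian varieties over finite fields*, arXiv:2309.13806 (2023; PREPRINT — no journal record 2026-08) (source `arxiv-2309.13806-src/main.tex`; corpus PDF text `paper:arxiv-2309.13806`) [cite: Shmakov2023, Thm 5.3 = `Theorem3`, its part for 1 ≤ n ≤ 3 (source l.857, l.854)]: l.854 "We obtain the following result, which is unconditional for \(1\leq n\leq 3\) on the basis of point counts"[…] / (Theorem `Theorem3`, whose first sentence — line comment below — assumes the paper's conj.s `EichlerShimura3`, `MiddleGalois` for the general case) l.857 "Then the compactly supported Euler characteristic \(e_\mathrm{c}(\mathcal{X}^{\times n}_3,\mathbb{Q}_\ell)\) is Tate type for all \(1\leq n\leq 5\), and are given by:" [sic] l.859 "e_\mathrm{c}(\mathcal{X}_3,\mathbb{Q}_\ell) &= \mathbb{L}^9+2\mathbb{L}^8+3\mathbb{L}^7+4\mathbb{L}^6+3\mathbb{L}^5+2\mathbb{L}^4+2\mathbb{L}^3+1" [and the displayed polynomials for n = 2, …, 5].  THE FIELD = the cases 1 ≤ n ≤ 3, which the author states unconditionally. -/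
  Shmakov : Prop
  /-- C97: T. Mégarbané, *Traces des opérateurs de Hecke sur les espaces de formes automorphes de SO₇, SO₈ ou SO₉ en niveau 1 et poids arbitraire*, J. Théor. Nombres Bordeaux 30 (2018) no. 1, 239–306, doi:10.5802/jtnb.1026 (corpus TeX `paper:arxiv-1604.01914`) [cite: Megarbane2018JTNB, Thms 1.0.3–1.0.6 (p0004:L21, L29, L33, L39) with Thms 6.1.1–6.1.3 (p0028)]: "Théorème 1.0.3. Soient $25\geq w_1>w_2>w_3\geq 1$ des entiers impairs, tels que l'ensemble $\Pi$ des éléments $\pi\in \Pi_{\mathrm{alg}}^\bot(\mathrm{PGL}_6)$ dont les poids sont les $\pm \frac{w_1}{2},\pm \frac{w_2}{2}, \pm \frac{w_3}{2}$est non vide (et possède dans ce cas un ou deux éléments)." / "$(iii)$ Pour $p\leq 53$ un nombre premier impair, la quantité $p^{w_1 /2 }\cdot \sum_{\pi \in \Pi } \mathrm{Trace} \left( \mathrm{c}_p (\pi) \vert V_\mathrm{St} \right) \in \Z$ est donnée par les tables (tableau3SO7), (tableau4SO7) et (tableau5SO7)." (and Théorèmes 1.0.4–1.0.6 for PGL₈,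 PGL₇: the Satake parameters / traces of the level-one algebraic regular self-dual cuspidal representations of Chenevier–Renard, from the traces of Hecke operators on 𝓜_W(SO₇), 𝓜_W(SO₈), 𝓜_W(SO₉), Thms 6.1.1–6.1.3). -/
  MegarbaneSO : Prop
  /-- C113: T. Mégarbané, *Calcul des opérateurs de Hecke sur les classes d'isomorphisme de réseaux pairs de déterminant 2 en dimension 23 et 25*, J. Number Theory 186 (2018) 370–416, doi:10.1016/j.jnt.2017.10.009 (corpus TeX `paper:arxiv-1607.03613`) [cite: Megarbane2018JNT, Thms 1.0.1–1.0.5 (p0004:L11, L15, L27, L37; p0005:L15)]: "Théorème 1.0.1. Pour $n=23$ et $p\leq 113$, ou $n=25$ et $p\leq 67$, l'endomorphisme $\mathrm{T}_p\in \mathrm{End}(\Z[X_n])$ est donné dans [MegTp]." (X_n = the isomorphism classes of even lattices of determinant 2 in dimension n); "Théorème 1.0.3. Pour tout nombre premier $p$, on a la congruence :" [τ_{4,10}-type congruences]; Théorème 1.0.5 (p0005:L15, verbatim in the line comment below): the Gan–Gross–Prasad criterion holds for π ∈ Π_disc(O₂₄), π′ ∈ Π_cusp(SO₂₃) and for π′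 ∈ Π_cusp(SO₂₅), π ∈ Π_disc(O₂₄). -/
  MegarbaneLattices : Prop
  /-- C109: M. Manji, *Euler systems and Selmer bounds for GU(2,1)*, Q. J. Math. 76 (2025) no. 1, 217–235, doi:10.1093/qmath/haae070 (corpus TeX `paper:arxiv-2208.01102`) [cite: Manji2025, Thms 4.3, 5.1, 5.3 (p0010:L11, p0012:L12, p0013:L3)]: "Theorem 4.3. Assume that $V$ is ordinary at $p$, satisfies the big image criteria and $\eta$ is a Hecke character satisfying the vanishing conditions of Lemma 3.1. Suppose further that the bottom class of the Euler system satisfies $e_{\bar{\eta}} c^\Pi_1 \neq 0$. Then the following statements hold:" / "* $e_{\bar{\eta}} H^1_{\mathcal{F}^*_+}(E,\mathbb{T}^*(1))^\vee$ is $\Lambda_{\bar{\eta}}$-torsion," […]; Theorem 5.1 (p split in E, V ordinary, big image, e_η̄ L_p^*(Π, 1+𝐣) ≠ 0): "* $ \mathrm{char}_{\Lambda_{\bar{\eta}} } \left(e_{\bar{\eta}} \widetilde{H}^2(\mathcal{O}_{E,S},\mathbb{T};\Delta^0)\right) \mid \frac{_{\bar{\eta}} L^*_p(\Pi, 1+ \bf{j})}{\Omega}$."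 [sic]; Theorem 5.3 (Selmer rank ≤ order of vanishing of L_p^*(Π, 1+𝐣) at 𝐣 = η) — for V = V_𝔓(Π)^* attached to a RAECSDC Π on GL₃/E, E imaginary quadratic, via GU(2,1). -/
  Manji : Prop

variable (ν : Nodes) (μ : Mok2015.Nodes) (κ : KMSW2014.Nodes) (c : Consumers) (c₂ : Consumers2) (c₁₃ : Consumers13)
  (c₁₄ : Consumers14) (c₂₄ : Consumers24) (c₃₂ : Consumers32)

-- Verbatim, kept out of docstrings by the docstring lint.  C93 (`paper:arxiv-2207.05130`): the node, p0002:L26 "Conjecture 3. Every semisimple geometric Galois representation of motivic weight at most $22$, and with non-negative Hodge–Tate weights, is a direct sum of representations $\phi_j$ for $1\leq j \leq 11$ tensored with $\Ll^k$ for some $k \geq 0$."; the hypothesis sentence of each theorem: p0003:L21 "Assume that Conjecture (conj-gal) holds. Let $\mathcal X$ be a smooth and proper Deligne–Mumford stack"[…]; p0006:L88 "Assume that Conjecture (conj-gal) and equation (conj844) hold. Then [BFvdG2] is true for all $\lambda$ such that $|\lambda| \leq 16$."; p0007:L23 "Assume that Conjecture (conj-gal) is true. For all partitions $\mu$ of $n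 \leq 14$,"[…]; the intro p0001:L10 "We stress the strong implications this has for several moduli spaces of central interest in algebraic geometry. For example, assuming Conjecture (conj-gal), we determine the cohomology groups of the"[…].
-- C94 (`arxiv-2309.13806-src/main.tex`): exact title l.38 "\title{Cohomological Arithmetic Statistics for Principally Polarized Abelian Varieties over Finite Fields}"; l.854 "We obtain the following result, which is unconditional for \(1\leq n\leq 3\) on the basis of point counts (but is very much conditional on the above conjectures in the case \(n\geq 4\)):" / Theorem `Theorem3` first sentence l.857 "\label{Theorem3} Assume conjectures \ref{EichlerShimura3} and \ref{MiddleGalois}. Then the compactly supported Euler characteristic \(e_\mathrm{c}(\mathcal{X}^{\times n}_3,\mathbb{Q}_\ell)\) is Tate type for all \(1\leq n\leq 5\), and are given by:"; l.776 "In view of \cite[Theorem 1.9]{CanningLarsonPayne2}, using the classification results of Chevevier-Ta\"ibi \cite{ChenevierTaibi}, the conjecture is true for all \((\lambda_1,\lambda_2,\lambda_3)\) with \(\lambda_1+\lambda_2+\lambda_3\leq 10\) on the basis of these point counts. The conjecture is claimed to be proven unconditionally by unpublished work of Ta\"ibi \cite{TaibiAg}."; the two conj.s: l.760 "\label{EichlerShimura3}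 \cite[Conjecture 7.1]{BFvdG3} For \(\lambda_1\geq\lambda_2\geq\lambda_3\) with \(\lambda_1+\lambda_2+\lambda_3>0\) even we have" / l.851 "\label{MiddleGalois} Any irreducible \(\ell\)-adic Galois representation of dimension \(7\) or \(8\) occurring in \(H^*(\mathcal{A}_3,\mathbb{V}_\lambda)\) can only occur in \(H^6(\mathcal{A}_3,\mathbb{V}_\lambda)\)."; « unpublished work of Taïbi » = l.1236 "\textit{On the cohomology of local systems on $\mathcal{A}_g$}." / l.1237 "In preparation."
-- C97 (`paper:arxiv-1604.01914`) p0035:L51 "Conjecture 7.3.3 (Conjecture d'Arthur-Langlands). Soient $G$ un $\Z$-groupe semi-simple et $r: \widehat{G}\rightarrow \mathrm{SL}_n$ une $\C$-représentation. Si $\pi \in \Pi_{\mathrm{disc}} (G)$, alors $\psi (\pi,r) \in \mathcal{X}_{\mathrm{AL}}\left( \mathrm{SL}_n \right)$." / p0035:L53 "Théorème 7.3.4. La conjecture d'Arthur-Langlands est vraie pour $G=\mathrm{SO}_n$ et $r=V_{\mathrm{St}}$."; C113 (`paper:arxiv-1607.03613`) p0009:L13 "Avec ce formalisme, la conjecture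 d'Arthur-Langlands [Lan] [Art89] se formule facilement (voir [CL])." / "Lorsque $G=\mathrm{SO}_n$ et que l'on considère la représentation standard de $\widehat{G}$, cette conjecture a été vérifiée par Taïbi [Tai16]"[…]; p0005:L15 "Théorème 1.0.5. La conjecture de Gan-Gross-Prasad est bien vérifiée lorsque $\pi\in\Pi_{\mathrm{disc}}(\mathrm{O}_{24})$ et $\pi'\in \Pi_{\mathrm{cusp}}(\mathrm{SO}_{23})$, ou lorsque $\pi'\in \Pi_{\mathrm{cusp}}(\mathrm{SO}_{25})$ et $\pi\in\Pi_{\mathrm{disc}}(\mathrm{O}_{24})$."; p0005:L9 "Enfin, nos résultats valident dans certains cas particuliers une conjecture de Gan-Gross-Prasad, exposée en conclusion de [GGP]."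
-- C109 (`paper:arxiv-2208.01102`) p0003:L4 "The aim of this paper is to look at a certain part of the machinery, the Iwasawa main conjectures, and adapt the results for the GU(2,1) Euler system. Partial results have been obtained (see Theorem 3.3 and corollary 3.6), and will hopefully lead to progress towards the Bloch–Kato conjecture for GU(2,1)."

/-- C93, the places the register is reached (`paper:arxiv-2207.05130`, corpus TeX) — the book itself is NOT cited.  CHENEVIER–LANNES (row C5's starred statement, restated as the paper's Theorem 1): p0001:L6 "The central role in this paper is played by a classification result of Chenevier and Lannes [ChLa]. For $n\ge1$, they classify the level $1$ algebraic cuspidal automorphic representations of $\PGL_n$ of motivic weight $w\le22$. There are $11$ of them, given in Theorem (thm-CL)." / p0001:L32 "The classification result of Chenevier and Lannes [ChLa] reads as follows." / "Theorem 1. Let $n\ge1$, and let $\pi\in\pc(\PGL_n)$ be an algebraic cuspidal automorphic representation of motivic weight at most $22$. Then $\pi$ is one of the following $11$ representations:" […the eleven representations 1, Δ₁₁, Δ₁₅, Δ₁₇, Δ₁₉, Δ_{19,7}, Δ₂₁, Δ_{21,5}, Δ_{21,9}, Δ_{21,13}, Sym²Δ₁₁…] / "Further strong results along these lines, as well as a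 simplification of the proof of Theorem (thm-CL), have been obtained by Chenevier and Taïbi [ChTa]. See also the earlier work by Chenevier and Renard [ChRe]." (row C6 and row C3 named, not used as inputs).  TAÏBI (row C4): p0007:L3 "By [Taibi] it follows that $s_{n(\lambda)}=0$ for all $|\lambda| \leq 16$ except when $\lambda=(8,4,4)$, for which $s_{n(\lambda)}=1$."  Bibliography p0009: "G. Chenevier and J. Lannes," / "Automorphic forms and even unimodular lattices. Kneser neighbors of Niemeier lattices (translated from the French by R. Erné)," (= row C5, [cite: ChenevierLannes2019]); "[Taibi]" / "Dimensions of spaces of level one automorphic forms for split classical groups using the trace formula," (= row C4).  Premises: row C5, row C4, the node `BFgal`.  No sentence on the status of the classification behind [ChLa] / [Taibi] (grep conditional: only the authors' own « assuming Conj. » clauses and « determined unconditionally » remarks about point counts).  Published Arthur-free inputs absorbed: Deligne (Weil II), Taylor and Edixhoven – van den Bogaart (purity), Getzler, Bergström's point counts, Canning–Larson, Hain, Faltings–Chai. [cite: BergstromFaber2023, §§1–2, 6–7 (p0001, p0007 as located)] -/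
def E_BergstromFaber : Prop := c.ChenevierLannesStar → c.TaibiDim → c₃₂.BFgal → c₃₂.BergstromFaber

/-- C94, the places the register is reached (`arxiv-2309.13806-src/main.tex`) — the book itself is NOT cited (« Arthur » occurs only in « Arthur-Selberg trace formula » and the acknowledgements).  CHENEVIER–TAÏBI (row C6): l.140 "In view of \cite[Theorem 1.9]{CanningLarsonPayne2}, using the classification results of Chevevier-Ta\"ibi \cite{ChenevierTaibi}, these computations are unconditional for \(1\leq n\leq 3\) on the basis of point counts." and, for the Bergström–Faber–van der Geer formula for λ₁+λ₂+λ₃ ≤ 10, the same classification (l.776, verbatim in the line comment above; that sentence also reports the formula l.776 "claimed to be proven unconditionally by unpublished work of Ta\"ibi \cite{TaibiAg}.").  TAÏBI's dimensions (row C4): l.778 "which are obtained by combining \ref{EichlerShimura3} with the vanishing \(S_{\lambda_1-\lambda_2,\lambda_2-\lambda_3,\lambda_3+4}(\Gamma(1))\) for all \(\lambda_1\geq\lambda_2\geq\lambda_3\geq 0\) with \(\lambda_1,\lambda_2,\lambda_3\leq 6\) obtained by \cite{Taibi}"[…].  Bibliography: l.1071 "\bibitem{ChenevierTaibi}" (=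 row C6, [cite: ChenevierTaibi2020]), l.1229 "\bibitem{Taibi}" (= row C4, [cite: Taibi2017]).  Premises: row C6, row C4.  No sentence on the status of the classification behind them; the sentence on « unpublished work of Taïbi » (line comment above) concerns the cohomology of local systems on 𝓐_g.  Published Arthur-free inputs absorbed: Canning–Larson–Payne, Hain, Petersen, Getzler–Kapranov, Lee's Sage program, Faltings–Chai. [cite: Shmakov2023, §1 and §5 (source l.140, l.776)] -/
def E_Shmakov : Prop := c.ChenevierTaibi → c.TaibiDim → c₃₂.Shmakov

/-- C97, the places the classification is invoked (`paper:arxiv-1604.01914`, corpus TeX).  THE BOOK AND [CR] (rows C3): p0004:L3 "Au chapitre (7), nous rappelons, en suivant Arthur [Art13] et Chenevier-Renard [CR], comment les formes automorphes pour $\mathrm{SO}_n$ étudiées ci-dessus sont “construites" à partir de certaines représentations automorphes des groupes linéaires. Cela nous permet, par un procédé de “récurrence sur $n$" décrit au paragraphe (7.4), d'utiliser nos calculs pour déterminer des paramètres de Satake des représentations des groupes linéaires mises en jeu. Soyons plus précis." / p0004:L17 "Dans leur travail [CR], Chenevier et Renard ont déterminé pour $n \leq 8$ (et $n \neq 7$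 en général), le nombre d'éléments de $\Pi_{\mathrm{alg}}^\bot(\mathrm{PGL}_n)$ de poids donné."  THE ARTHUR–LANGLANDS STATEMENT FOR SO_n (rows A3, B1): Théorème 7.3.4 (p0035:L53, for G = SO_n and r = V_St; verbatim in the line comment above) with its proof "ce théorème est le produit de travaux de nombreux auteurs (Arthur [Art13], Langlands, Kottwitz, Shelstad [She12a] [She12b] [She14], Waldspurger [Wal06] [Wal14] [MW14] [LW13], Ngô [Ngo10], Laumon, Chaudouard [ChaL10] [ChaL12], Moeglin, Mezo [Mez11] [Mez13]), culminant par les travaux récents d'Arthur et Waldspurger." / "L'énoncé ci-dessus, concernant $\mathrm{SO}_n$, est dû à Taïbi [Tai16] et repose sur [Art89] et les travaux de Kaletha [Kal] et Arancibia-Moeglin-Renard [AMR]."  STATUS SENTENCE (asserts the opposite; p0004:L17): "Soulignons que les résultats de [CR] ne sont plus conditionnels, grâce notamment aux travaux récents de Waldspurger [Wal14], Kaletha [Kal], Taïbi [Tai16] et Arancibia-Moeglin-Renard [AMR]."  Bibliography p0039: "[Art13] J. Arthur, The endoscopic classification of representations : orthogonal and symplectic groups, Colloquium Publ. 61, Amer.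 Math. Soc. (2013)." / "[CR] G. Chenevier et D. Renard, Level one algebraic cusp forms of classical groups of small rank, Mem. Amer Math. Soc. 1121, 128p (2015)." (= rows C3) / "[Tai16] O. Taïbi, Arthur's multiplicity formula for certain inner forms of special orthogonal and symplectic groups, à paraître dans Journal of the European Mathematical Society." (= row A3) / "[AMR] N. Arancibia, C. Moeglin et D. Renard, Paquets d'Arthur des groupes classiques et unitaires, disponible à l'url <http://arxiv.org/abs/1507.01432>." (= row B1).  Premises: the book at all ranks, rows C3 (★ and ★★: the definite SO_n computations of [CR] carry both marks), A3, B1.  Published Arthur-free inputs absorbed: Gross's formula, the neighbour method, Weyl's character formula, Nebe–Venkov, Conway–Sloane. [cite: Megarbane2018JTNB, §§1, 7.3 (p0004, p0035 as located)] -/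
def E_MegarbaneSO : Prop :=
  (∀ N, ν.Everything N) → c.ChenevierRenardStar → c.ChenevierRenardStarStar → c.TaibiInner → c.AMR → c₃₂.MegarbaneSO

/-- C113, the places the classification is invoked (`paper:arxiv-1607.03613`, corpus TeX) — [Art13] stands in the bibliography (p0022:L7) without a citation in the body.  CHENEVIER–LANNES / CHENEVIER–RENARD (rows C5, C3): p0005:L11 "Les paramètres standards de telles représentations ont été déterminés dans [CL] pour les éléments de $\Pi_{\mathrm{cusp}}(\mathrm{SO}_{23})$, [CL] pour les éléments de $\Pi_{\mathrm{disc}}(\mathrm{O}_{24})$ et [CR] pour les éléments de $\Pi_{\mathrm{cusp}}(\mathrm{SO}_{25})$." / p0004:L5 "La méthode qu'on utilise est la même que celle déjà utilisée par Chenevier-Lannes [CL] en dimension $24$."  THE ARTHUR–LANGLANDS STATEMENT FOR SO_n (rows A3, B1): p0009:L13 "vérifiée par Taïbi [Tai16], dont les résultats reposent sur les travaux d'Arthur [Art89], ainsi que sur ceux de Kaletha [Kal] et Arancibia-Moeglin-Renard [AMR]." (the Arthur–Langlands statement for SO_n and the standard representation; full sentence in the line comment above)  Bibliography: "[CL] G.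 Chenevier et J. Lannes, Formes automorphes et voisins de Kneser des réseaux de Niemeier." (= row C5) / "[CR] G. Chenevier et D. Renard, Level one algebraic cusp forms of classical groups of small rank, Mem. Amer Math. Soc. 1121, 128p (2015)." (= rows C3) / "[Tai16] O. Taïbi, Arthur's multiplicity formula for certain inner forms of special orthogonal and symplectic groups, à paraître dans Journal of the European Mathematical Society." (= row A3) / "[AMR] N. Arancibia, C. Moeglin et D. Renard, Paquets d'Arthur des groupes classiques et unitaires, disponible à l'url <http://arxiv.org/abs/1507.01432>." (= row B1).  Premises: rows C5, C3 (★★: the definite SO₂₅ / O₂₄ tables), A3, B1; no direct book premise.  No status sentence.  Published Arthur-free inputs absorbed: Niemeier, Borcherds, Conway–Sloane, Nebe–Venkov, Gross's formula, Plesken–Souvignier. [cite: Megarbane2018JNT, §§1, 2.2 (p0004, p0005, p0009 as located)] -/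
def E_MegarbaneLattices : Prop :=
  c.ChenevierLannesStar → c.ChenevierRenardStarStar → c.TaibiInner → c.AMR → c₃₂.MegarbaneLattices

/-- C109, the places the classifications are invoked (`paper:arxiv-2208.01102`, corpus TeX).  MOK'S MEMOIR DIRECTLY (base change for GU(2,1)): p0004:L16 "We are interested in cuspidal automorphic representations of $G$, and we can relate ($L$-packets of) these to ($L$-packets of) cuspidal automorphic representations of $\mathrm{Res}^{E}_{\mathbb{Q}}(\mathrm{GL}_3 \times \mathrm{GL}_1)$ via base change, following the notation of [LSZ21], via the referenced result of Mok." / "Theorem 2.2 ([Mok15] and others). Given a RAECSDC representation $(\Pi, \omega)$ of $\mathrm{GL}_3/E$, there exists a unique globally generic, cuspidal automorphic representation $\pi$ of $G$ such that the base change of $\pi_v$ at a place $w \mid v$ is $\Pi_w$, and $\pi$ has central character $\chi^{c}_{\Pi}/(\omega \circ N_{E/\mathbb{Q}})$."  THE EULER SYSTEM OF [LSZ21] (row C110): p0006:L45 "Theorem 3.3 ([LSZ21], Theorem 12.3.1). Assume $\Pi$ is ordinary at $p$, then there exists a lattice $T=T_\mathfrak{P}(\Pi)^* \subset V$, and a collection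 of classes"  Bibliography p0015: "[Mok15]" / "Chung Pang Mok, Endoscopic classification of representations of" […]; [LSZ21] = Loeffler–Skinner–Zerbes, *Euler systems for GU(2,1)*, Math. Ann. (2022) = row C110 [cite: LoefflerSkinnerZerbes2021].  Premises: Mok's memoir at all ranks, row C110 (itself ⇐ Mok).  No status sentence (grep conditional / unpublished: 0 on the classification).  Published Arthur-free inputs absorbed: BLGHT (Galois representations), Xia, Mazur–Rubin, Kings–Loeffler–Zerbes, Nekovář. [cite: Manji2025, §§2–3 (p0004, p0006 as located)] -/
def E_Manji : Prop := (∀ N, μ.Everything N) → c₂₄.LSZEuler → c₃₂.Manji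

/-- The thirty-second tranche of implications. [cite: BergstromFaber2023, Thms 6, 22, 26; Shmakov2023, Thm 5.3; Megarbane2018JTNB, Thms 1.0.3–1.0.6; Megarbane2018JNT, Thms 1.0.1–1.0.5; Manji2025, Thms 4.3, 5.1, 5.3 (each edge's source in its own docstring)] -/
structure Implications32 : Prop where
  bergstromFaber : E_BergstromFaber c c₃₂
  shmakov : E_Shmakov c c₃₂
  megarbaneSO : E_MegarbaneSO ν c c₃₂
  megarbaneLattices : E_MegarbaneLattices c c₃₂
  manji : E_Manji μ c₂₄ c₃₂

variable {ν μ κ c c₂ c₁₃ c₁₄ c₂₄ c₃₂}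

/-- C93 given rows C5, C4 and the authors' Galois hypothesis. [cite: BergstromFaber2023, Thms 6, 22, 26 (bookkeeping proved here)] -/
theorem bergstromFaber_of_rows_and_hypothesis (X : Implications32 ν μ c c₂₄ c₃₂) (h₅ : c.ChenevierLannesStar)
    (h₄ : c.TaibiDim) (hG : c₃₂.BFgal) : c₃₂.BergstromFaber :=
  X.bergstromFaber h₅ h₄ hG

/-- C93 from the book's inputs (C5 through `chenevierLannes_of_leaves`, C4 through `taibiDim_of_leaves`) AND the node.
[cite: BergstromFaber2023, Thms 6, 22, 26 (bookkeeping proved here)] -/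
theorem bergstromFaber_of_leaves_and_hypothesis (X : Implications32 ν μ c c₂₄ c₃₂) (I : Implications ν μ κ c)
    (A : BookInputs ν) (hG : c₃₂.BFgal) : c₃₂.BergstromFaber :=
  X.bergstromFaber (chenevierLannes_of_leaves I A) (taibiDim_of_leaves I A) hG

/-- C93 in conditional form, 2026 (no status sentence on the classification): given the node, Theorems 6, 22, 26 are
conditional on the 2024–2026 preprint layer and on the general and the non-standard weighted fundamental lemmas, AT
SECOND ORDER through [ChLa] and [Taibi]. [cite: BergstromFaber2023, §1 (bookkeeping proved here)] -/
theorem bergstromFaber_conditional_form (X : Implications32 ν μ c c₂₄ c₃₂) (I : Implications ν μ κ c) (B : ν.BookEdges)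
    (S : ν.SupplyEdges) (P : ν.PublishedLeaves) (hG : c₃₂.BFgal) :
    ν.PreprintLeaves2026 → ν.WFL_general → ν.WFL_nonstandard → c₃₂.BergstromFaber :=
  fun hQ h6 h7 => bergstromFaber_of_leaves_and_hypothesis X I ⟨B, S, P, hQ, ⟨h6, h7⟩⟩ hG

/-- C94 from the book's inputs (C6 through `chenevierTaibi_of_leaves`, C4 through `taibiDim_of_leaves`). [cite: Shmakov2023, Thm 5.3, 1 ≤ n ≤ 3 (bookkeeping proved here)] -/
theorem shmakov_of_leaves (X : Implications32 ν μ c c₂₄ c₃₂) (I : Implications ν μ κ c) (A : BookInputs ν) :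
    c₃₂.Shmakov :=
  X.shmakov (chenevierTaibi_of_leaves I A) (taibiDim_of_leaves I A)

/-- C94 in conditional form, 2026, against the author's « unconditional for 1 ≤ n ≤ 3 »: as typed (through [16] and
[48]) the displayed Euler characteristics are conditional on the 2024–2026 preprint layer and on the general and the
non-standard weighted fundamental lemmas. [cite: Shmakov2023, §1 (bookkeeping proved here)] -/
theorem shmakov_conditional_form (X : Implications32 ν μ c c₂₄ c₃₂) (I : Implications ν μ κ c) (B : ν.BookEdges)
    (S : ν.SupplyEdges) (P : ν.PublishedLeaves) :
    ν.PreprintLeaves2026 → ν.WFL_general → ν.WFL_nonstandard → c₃₂.Shmakov :=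
  fun hQ h6 h7 => shmakov_of_leaves X I ⟨B, S, P, hQ, ⟨h6, h7⟩⟩

/-- C97 from the book's inputs (rows C3, A3, B1 through their `_of_leaves` theorems). [cite: Megarbane2018JTNB, Thms 1.0.3–1.0.6 (bookkeeping proved here)] -/
theorem megarbaneSO_of_leaves (X : Implications32 ν μ c c₂₄ c₃₂) (I : Implications ν μ κ c) (A : BookInputs ν) :
    c₃₂.MegarbaneSO :=
  X.megarbaneSO A.everything (chenevierRenardStar_of_leaves I A) (chenevierRenardStarStar_of_leaves I A)
    (taibiInner_of_leaves I A) (amr_of_leaves I A)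

/-- C97 in conditional form, 2026, AGAINST the author's sentence « les résultats de [CR] ne sont plus conditionnels »
(2016/2018): as typed, Théorèmes 1.0.3–1.0.6 are conditional on the 2024–2026 preprint layer and on the general and the
non-standard weighted fundamental lemmas. [cite: Megarbane2018JTNB, §1 p0004 (bookkeeping proved here)] -/
theorem megarbaneSO_conditional_form (X : Implications32 ν μ c c₂₄ c₃₂) (I : Implications ν μ κ c) (B : ν.BookEdges)
    (S : ν.SupplyEdges) (P : ν.PublishedLeaves) :
    ν.PreprintLeaves2026 → ν.WFL_general → ν.WFL_nonstandard → c₃₂.MegarbaneSO :=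
  fun hQ h6 h7 => megarbaneSO_of_leaves X I ⟨B, S, P, hQ, ⟨h6, h7⟩⟩

/-- C113 from the book's inputs, at second order only (rows C5, C3, A3, B1). [cite: Megarbane2018JNT, Thms 1.0.1–1.0.5 (bookkeeping proved here)] -/
theorem megarbaneLattices_of_leaves (X : Implications32 ν μ c c₂₄ c₃₂) (I : Implications ν μ κ c) (A : BookInputs ν) :
    c₃₂.MegarbaneLattices :=
  X.megarbaneLattices (chenevierLannes_of_leaves I A) (chenevierRenardStarStar_of_leaves I A) (taibiInner_of_leaves I A)
    (amr_of_leaves I A)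

/-- C113 in conditional form, 2026 (no status sentence). [cite: Megarbane2018JNT, §2.2 (bookkeeping proved here)] -/
theorem megarbaneLattices_conditional_form (X : Implications32 ν μ c c₂₄ c₃₂) (I : Implications ν μ κ c)
    (B : ν.BookEdges) (S : ν.SupplyEdges) (P : ν.PublishedLeaves) :
    ν.PreprintLeaves2026 → ν.WFL_general → ν.WFL_nonstandard → c₃₂.MegarbaneLattices :=
  fun hQ h6 h7 => megarbaneLattices_of_leaves X I ⟨B, S, P, hQ, ⟨h6, h7⟩⟩

/-- C109 from Mok's inputs (directly and through C110's `lszEuler_of_leaves`); the book and KMSW occur in no premise.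
[cite: Manji2025, Thms 4.3, 5.1, 5.3 (bookkeeping proved here)] -/
theorem manji_of_leaves (X : Implications32 ν μ c c₂₄ c₃₂) (Z : Implications24 ν μ κ c₂ c₁₃ c₁₄ c₂₄) (M : MokInputs μ) :
    c₃₂.Manji :=
  X.manji M.everything (lszEuler_of_leaves Z M)

/-- C109 in conditional form, 2026 (no status sentence): granting Mok's section derivations, supply edges and every
PUBLISHED input of the memoir, Theorems 4.3, 5.1, 5.3 are conditional on the memoir's 2024–2026 preprint layer and on
its general and non-standard weighted fundamental lemmas. [cite: Manji2025, §2 (bookkeeping proved here)] -/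
theorem manji_conditional_form (X : Implications32 ν μ c c₂₄ c₃₂) (Z : Implications24 ν μ κ c₂ c₁₃ c₁₄ c₂₄)
    (MB : μ.SectionEdges) (MS : μ.SupplyEdges) (MP : μ.PublishedLeaves) :
    μ.PreprintLeaves2026 → μ.WFL_general → μ.WFL_nonstandard → c₃₂.Manji :=
  fun hQ m6 m7 => manji_of_leaves X Z ⟨MB, MS, MP, hQ, ⟨m6, m7⟩⟩

/-- The level-one line of the tranche from the book's inputs, the node granted for C93. [cite: BergstromFaber2023, Thms 6, 22, 26; Shmakov2023, Thm 5.3; Megarbane2018JTNB, Thms 1.0.3–1.0.6; Megarbane2018JNT, Thms 1.0.1–1.0.5 (bookkeeping proved here)] -/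
theorem levelOneLine_of_book (X : Implications32 ν μ c c₂₄ c₃₂) (I : Implications ν μ κ c) (A : BookInputs ν) :
    (c₃₂.BFgal → c₃₂.BergstromFaber) ∧ c₃₂.Shmakov ∧ c₃₂.MegarbaneSO ∧ c₃₂.MegarbaneLattices :=
  ⟨fun hG => bergstromFaber_of_leaves_and_hypothesis X I A hG, shmakov_of_leaves X I A, megarbaneSO_of_leaves X I A,
    megarbaneLattices_of_leaves X I A⟩

/-- All five rows of the tranche from the book's and Mok's inputs, the node granted (KMSW occurs in no edge).
[cite: Manji2025, Thms 4.3, 5.1, 5.3, with the four rows of `levelOneLine_of_book` (bookkeeping proved here)] -/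
theorem thirtysecond_of_inputs_and_hypothesis (X : Implications32 ν μ c c₂₄ c₃₂) (Z : Implications24 ν μ κ c₂ c₁₃ c₁₄ c₂₄)
    (I : Implications ν μ κ c) (A : BookInputs ν) (M : MokInputs μ) (hG : c₃₂.BFgal) :
    (c₃₂.BergstromFaber ∧ c₃₂.Shmakov ∧ c₃₂.MegarbaneSO ∧ c₃₂.MegarbaneLattices) ∧ c₃₂.Manji :=
  ⟨⟨bergstromFaber_of_leaves_and_hypothesis X I A hG, shmakov_of_leaves X I A, megarbaneSO_of_leaves X I A,
    megarbaneLattices_of_leaves X I A⟩, manji_of_leaves X Z M⟩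

end Downstream

end Literature.NumberTheory.Automorphic.Arthur2013
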